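import Summits.HubbardSuperconductivity.HubbardSuperconductivity.Theses.ChiralWindow
import Summits.HubbardSuperconductivity.HubbardSuperconductivity.Theorems.ThermalWedgeTwSourcedInertnessReduction
import Literature.MathematicalPhysics.QuantumLattice.DWaveOrderParameterProofs
import Literature.MathematicalPhysics.QuantumLattice.DWaveSourceFreeGainBound
import Literature.MathematicalPhysics.QuantumLattice.LiebFluxPhaseProofs
import Literature.MathematicalPhysics.QuantumLattice.DWaveSourceFreePressure
import Literature.MathematicalPhysics.QuantumLattice.TorusShellCounting
import Literature.MathematicalPhysics.QuantumLattice.PairFieldMomentum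

/-!
# Disproof of `CwChiralConstruction` (stmt-HubbardSuperconductivity-1740) — findings

Standing adversary's work file (refuter, cdisprove mode; route `ChiralWindow`, rank-2 crux, "the
programme"). CRUX (verbatim shape):
`∃ U₀ > 0, ∃ C > 0, ∀ U ∈ (0,U₀), ∃ δ ∈ [3/10, 12/25], ∃ μ : ℝ,
   (GC tracial ground-state density of hubbardTorusWith 2 (L+1) 1 U μ) → 1 - δ  ∧
   exp(-C/U²) ≤ dWaveOrderParameter U μ`.

VERDICT SO FAR (cycle 2, 2026-08-16): NOT REFUTED — and not refutable cheaply: a refutation is a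
theorem "no weak-coupling `d_{x²-y²}` order at ANY hole doping in [0.3, 0.48]", i.e. the negation of
Kohn–Luttinger folklore. What this file PROVES (all `lean check` rc 0, NO `sorry`; landed / landing under
`Theorems/CwChiralConstruction/Negative/{PressureSandwich (p74006 ACCEPTED), CooperLegendreCeiling,
BandCounting, FreeGasDensity, DensityPinning}.lean`, importable by ideators/planners):

* §A STAIRCASE FORM of the crux (`cwChiralConstruction_iff_staircase`): the order clause is the
  conjunction over ALL source strengths `h > 0` of `exp(-C/U²) ≤ F(U,μ,h)`,
  `F = liminf_L dWaveSourceDensity (L+1) U μ h` (tree: `le_dWaveOrderParameter_iff_forall`).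
* §B LOAD-BEARING FEATURES OF THE DEFINITION (cheap, from the sibling crux's Literature API):
  the source must stay on through `L → ∞` (`cw1740_false_sourceFree`) and the filter must be the
  punctured `𝓝[>] 0` (`cw1740_false_closedFilter`).
* §C THE COOPER–LEGENDRE CEILING (new; the main content): for every compact `[μ₁,μ₂] ⊂ (-4,0)` there
  is `K` with, for ALL real `U`, `μ ∈ [μ₁,μ₂]`, `h ∈ (0,1]`:
      `dWaveOrderParameter U μ ≤ F(U,μ,h) ≤ K(1+|log h|)h + |U|/h`
  (`liminf_dWaveSourceDensity_le_stair`, `dWaveOrderParameter_le_stair`); hence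
  `dWaveOrderParameter 0 μ = 0` (FREE GAS HAS NO ORDER, `dWaveOrderParameter_free_eq_zero`) and
  `dWaveOrderParameter U μ ≤ (K+1)(1+|log U|)√U` for `U ∈ (0,1]` (`dWaveOrderParameter_le_sqrt`).
  Proof: energy form of the stair (`dWaveSourceDensity ≤ (E(h)-E(2h))/(2hL²) ≤ (E(0)-E(2h))/(2hL²)`),
  `-log Z/β ≤ E₀ ≤ (log dim - log Z)/β`, the interacting-vs-free pressure comparison
  `|p̃(U) - p̃(0)| ≤ |U|` (route ThermalWedge's reduction file) and the tree's free BdG Cooper-log gain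
  bound `p̃₀(2h) - p̃₀(0) ≤ C₀(1+log β)(2h)²` at `β = h⁻²`, `L ≥ max(3,⌈β⌉)`.
* §D REFUTED STRENGTHENINGS: the `U`-dependence of the floor is load-bearing —
  `cw1740_false_uniformFloorOn`: the crux with `exp(-C/U²)` replaced by a constant `c₀ > 0` (and `μ`
  confined to any compact of the hole-doped free band `(-4,0)`, where the density clause puts it) is
  FALSE; more generally no floor `c·U^p` with `p < 1/2` survives (`cw1740_false_powerFloorOn`).
  Room left between ceiling `O(√U log(1/U))` (improvable to `O(U log(1/U))` by second-order
  perturbation theory, cf. WeakCouplingBCS item WcbcsLegendreCeiling) and floor `exp(-C/U²)`: this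
  gap IS the BCS/Kohn–Luttinger physics, and no known rigorous method enters it from either side.
* §F DENSITY PINNING (cycle 2, proved): `|U| ≤ 10⁻³` and GC density `→ n ∈ [0.52,0.70]` force
  `μ ∈ [-37/10, -1/20]`; hence §G: the VERBATIM crux (μ unrestricted) is FALSE with a constant floor,
  with any power floor `cU^p` (`p < 1/2`), or with `U ∈ [0,U₀)` in place of `(0,U₀)` — the three
  cheap deformations of the order clause all die; only the `exp(-C/U²)`-type floor survives.
* §H KL CENSUS (compute job j010500, non-certified, 2nd order, t'=0; evidence klcensus-j010500.md): B₁g LEADS on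
  n ∈ [0.60, 0.80] ⊃ window part δ ∈ [0.30, 0.40] (at δ = 0.30: a_{B1g} = 2.35e-3 vs a_E = 5.4e-4); first crossing
  B₁g = E at n* ≈ 0.59 (δ* ≈ 0.41, inside the window, partner E); B₂g within ~6 % of the bottom there (three-channel
  near-degeneracy — a warning for stmt-1741's isolation clause). Hence NO folklore-level kill either: the crux is
  "true but unproved", and its C is of order 1/a ∼ 4·10² (asymptotic statement only).
* §E WHY IT RESISTS (prose, end of file): (i) the refuter must beat every μ with GC density in
  [0.52, 0.70] — now pinned into [-3.7, -0.05], where the ceiling is `O(√U log(1/U))` and nothing better;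
  (ii) the `∃ δ` lets the prover sit at δ = 0.3 (n = 0.7) where every KL census (Hlubina 1999,
  Raghu–Kivelson–Scalapino 2010, Šimkovic et al. 2016) has B₁g leading — the route's crossing-line
  choice δ_U ≈ δ*(U) is NOT forced by the crux as typed, so kill criterion (i) of the route
  (crossing outside the window) would NOT refute this item; (iii) at a doping where another irrep
  leads, folklore says the B₁g order parameter is 0 and the crux would be false there — but one good
  δ per U suffices.
-/

noncomputable section

set_option linter.dupNamespace false

namespace Summit.HubbardSuperconductivity.HubbardSuperconductivity.Cruxes.CwChiralConstruction.Disproof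

open Matrix Finset Filter Literature.MathematicalPhysics.QuantumLattice Literature.Probability.LatticeModels
open Summit.HubbardSuperconductivity.HubbardSuperconductivity.Theses.ChiralWindow
open Summit.HubbardSuperconductivity.HubbardSuperconductivity.Theorems
open scoped Matrix.Norms.L2Operator ComplexOrder Topology

/-! ## §A The crux in staircase form -/

/-- The GC density clause of the crux, named (tracial ground-state density of
`hubbardTorusWith 2 (L+1) 1 U μ` tends to `1 - δ`). -/
def DensityClause (U μ δ : ℝ) : Prop :=
  Tendsto (fun L : ℕ => ((hubbardTorusWith 2 (L + 1) 1 U μ).groundStateFunctional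
    totalNumber).re / ((L + 1 : ℕ) : ℝ) ^ 2) atTop (𝓝 (1 - δ))

/-- The crux, verbatim, with the density clause folded into `DensityClause`. -/
theorem cwChiralConstruction_iff :
    CwChiralConstruction ↔
      ∃ U₀ : ℝ, 0 < U₀ ∧ ∃ C : ℝ, 0 < C ∧ ∀ U ∈ Set.Ioo (0:ℝ) U₀, ∃ δ ∈ Set.Icc (3/10 : ℝ) (12/25),
        ∃ μ : ℝ, DensityClause U μ δ ∧ Real.exp (-C / U ^ 2) ≤ dWaveOrderParameter U μ :=
  Iff.rfl

/-- **Staircase form.** The order clause `exp(-C/U²) ≤ dWaveOrderParameter U μ` is EXACTLY the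
conjunction over all source strengths `h > 0` of the floor on the stair
`F(U,μ,h) = liminf_L dWaveSourceDensity (L+1) U μ h` (tree lemma `le_dWaveOrderParameter_iff_forall`):
a prover must bound the sourced `d`-wave density from below at EVERY positive `h`, uniformly in
large `L`; a floor on stairs bounded away from `h = 0` proves nothing. -/
theorem cwChiralConstruction_iff_staircase :
    CwChiralConstruction ↔
      ∃ U₀ : ℝ, 0 < U₀ ∧ ∃ C : ℝ, 0 < C ∧ ∀ U ∈ Set.Ioo (0:ℝ) U₀, ∃ δ ∈ Set.Icc (3/10 : ℝ) (12/25),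
        ∃ μ : ℝ, DensityClause U μ δ ∧
          ∀ h : ℝ, 0 < h → Real.exp (-C / U ^ 2) ≤
            liminf (fun L : ℕ => dWaveSourceDensity (L + 1) U μ h) atTop := by
  rw [cwChiralConstruction_iff]
  simp only [le_dWaveOrderParameter_iff_forall]

/-! ## §B Load-bearing features of `dWaveOrderParameter` (cheap; sibling API) -/

/-- The crux with the source switched OFF before the thermodynamic limit (order parameter replaced by
`liminf_L dWaveSourceDensity (L+1) U μ 0`). -/
def CwChiralConstructionSourceFree : Prop :=
  ∃ U₀ : ℝ, 0 < U₀ ∧ ∃ C : ℝ, 0 < C ∧ ∀ U ∈ Set.Ioo (0:ℝ) U₀, ∃ δ ∈ Set.Icc (3/10 : ℝ) (12/25),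
    ∃ μ : ℝ, DensityClause U μ δ ∧
      Real.exp (-C / U ^ 2) ≤ liminf (fun L : ℕ => dWaveSourceDensity (L + 1) U μ 0) atTop

/-- **Any proof must keep the source on through `L → ∞`**: the source-free variant is FALSE for a
trivial reason (`U(1)` kills every anomalous average in finite volume, `dWaveSourceDensity_zero`). -/
theorem cw1740_false_sourceFree : ¬ CwChiralConstructionSourceFree := by
  rintro ⟨U₀, hU₀, C, _, H⟩
  obtain ⟨δ, _, μ, _, hle⟩ := H (U₀ / 2) ⟨by linarith, by linarith⟩
  exact not_exp_le_liminf_sourceFree C (U₀ / 2) μ hle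

/-- The crux with the CLOSED right neighbourhood `𝓝[≥] 0` in the outer liminf. -/
def CwChiralConstructionClosedFilter : Prop :=
  ∃ U₀ : ℝ, 0 < U₀ ∧ ∃ C : ℝ, 0 < C ∧ ∀ U ∈ Set.Ioo (0:ℝ) U₀, ∃ δ ∈ Set.Icc (3/10 : ℝ) (12/25),
    ∃ μ : ℝ, DensityClause U μ δ ∧
      Real.exp (-C / U ^ 2) ≤
        liminf (fun h : ℝ => liminf (fun L : ℕ => dWaveSourceDensity (L + 1) U μ h) atTop) (𝓝[≥] 0)

/-- **The punctured filter is load-bearing**: with `𝓝[≥] 0` the double liminf is `≤ 0`. -/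
theorem cw1740_false_closedFilter : ¬ CwChiralConstructionClosedFilter := by
  rintro ⟨U₀, hU₀, C, _, H⟩
  obtain ⟨δ, _, μ, _, hle⟩ := H (U₀ / 2) ⟨by linarith, by linarith⟩
  exact not_exp_le_liminf_nhdsGE C (U₀ / 2) μ hle

/-! ## §C The Cooper–Legendre ceiling on the order parameter at weak coupling -/

section Ceiling

/-- `log dim Fock((ℤ/Lℤ)²) = 2L² log 2`. -/
theorem log_card_fock (L : ℕ) :
    Real.log (Fintype.card (Finset (Orb (FermionTorus 2 L))) : ℝ) = 2 * (L : ℝ) ^ 2 * Real.log 2 := by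
  have hc : Fintype.card (Finset (Orb (FermionTorus 2 L))) = 2 ^ (2 * L ^ 2) := by
    rw [Fintype.card_finset]
    congr 1
    rw [show Fintype.card (Orb (FermionTorus 2 L)) = Fintype.card (FermionTorus 2 L × Fin 2) from
      Fintype.card_lex _, Fintype.card_prod, Fintype.card_fin, card_fermionTorus_two]
    ring
  rw [hc]
  push_cast
  rw [Real.log_pow]
  push_cast
  ring

variable {m : Type*} [Fintype m] [DecidableEq m] [Nonempty m]

/-- `-log Re Z_β / β ≤ E₀` (keep the ground-state term of `Z`). [folklore] -/
theorem neg_log_partitionFn_div_le_groundEnergy {H : Matrix m m ℂ} (hH : H.IsHermitian) {β : ℝ}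
    (hβ : 0 < β) : -Real.log (H.partitionFn β).re / β ≤ H.groundEnergy := by
  have h1 := exp_neg_mul_groundEnergy_le_partitionFn hH β
  have h2 := Real.log_le_log (Real.exp_pos _) h1
  rw [Real.log_exp] at h2
  rw [div_le_iff₀ hβ]
  linarith

/-- `E₀ ≤ (log dim - log Re Z_β) / β` (`Z ≤ dim · e^{-βE₀}`). [folklore] -/
theorem groundEnergy_le_log_card_sub_log_partitionFn_div {H : Matrix m m ℂ} (hH : H.IsHermitian)
    {β : ℝ} (hβ : 0 < β) :
    H.groundEnergy ≤ (Real.log (Fintype.card m) - Real.log (H.partitionFn β).re) / β := by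
  have h1 := partitionFn_le_card_mul_exp hH hβ.le
  have hpos : 0 < (H.partitionFn β).re :=
    lt_of_lt_of_le (Real.exp_pos _) (exp_neg_mul_groundEnergy_le_partitionFn hH β)
  have hD : (0 : ℝ) < Fintype.card m := by exact_mod_cast Fintype.card_pos
  have h2 := Real.log_le_log hpos h1
  rw [Real.log_mul hD.ne' (Real.exp_pos _).ne', Real.log_exp] at h2
  rw [le_div_iff₀ hβ]
  linarith

variable {L : ℕ} [NeZero L]

/-- **Energy drop through pressures.** For every `β > 0`:
`E_L(U,μ,0) - E_L(U,μ,2h) ≤ L²·[p̃_L(β,μ,U,2h) - p̃_L(β,μ,U,0)] + 2L² log 2 / β`. -/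
theorem groundEnergy_drop_le_pressureGain (U μ h : ℝ) {β : ℝ} (hβ : 0 < β) :
    (dWaveSourceTorus L U μ 0).groundEnergy - (dWaveSourceTorus L U μ (2 * h)).groundEnergy ≤
      (L : ℝ) ^ 2 * (Real.log (partitionFn β (dWaveSourceTorus L U μ (2 * h))).re / (β * (L : ℝ) ^ 2) -
          Real.log (partitionFn β (dWaveSourceTorus L U μ 0)).re / (β * (L : ℝ) ^ 2)) +
        2 * (L : ℝ) ^ 2 * Real.log 2 / β := by
  have hL := cast_sq_pos_of_neZero L
  have h0 := groundEnergy_le_log_card_sub_log_partitionFn_div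
    (isHermitian_dWaveSourceTorus L U μ 0) hβ
  have h2 := neg_log_partitionFn_div_le_groundEnergy (isHermitian_dWaveSourceTorus L U μ (2 * h)) hβ
  rw [log_card_fock] at h0
  set a := Real.log (partitionFn β (dWaveSourceTorus L U μ (2 * h))).re with ha
  set b := Real.log (partitionFn β (dWaveSourceTorus L U μ 0)).re with hb
  have hL0 : (L : ℝ) ^ 2 ≠ 0 := hL.ne'
  have e0 : (L : ℝ) ^ 2 * (a / (β * (L : ℝ) ^ 2) - b / (β * (L : ℝ) ^ 2)) = (a - b) / β := by
    rw [← sub_div, ← mul_div_assoc, div_mul_eq_div_div_swap, mul_div_cancel_left₀ _ hL0]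
  have e1 : (L : ℝ) ^ 2 * (a / (β * (L : ℝ) ^ 2) - b / (β * (L : ℝ) ^ 2)) + 2 * (L : ℝ) ^ 2 * Real.log 2 / β =
      (2 * (L : ℝ) ^ 2 * Real.log 2 - b) / β - (-a / β) := by
    rw [e0]
    ring
  rw [e1]
  linarith

/-- **The finite-volume stair bound.** For `h > 0`, `β > 0` and every `L`:
`dWaveSourceDensity L U μ h ≤ ([p̃_L(β,μ,0,2h) - p̃_L(β,μ,0,0)] + 2|U| + 2 log 2/β) / (2h)`
(energy form of the stair, the pressure sandwich, and `|p̃(U) - p̃(0)| ≤ |U|`). -/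
theorem dWaveSourceDensity_le_freeGain (U μ : ℝ) {h β : ℝ} (hh : 0 < h) (hβ : 0 < β) :
    dWaveSourceDensity L U μ h ≤
      ((Real.log (partitionFn β (dWaveSourceTorus L 0 μ (2 * h))).re / (β * (L : ℝ) ^ 2) -
          Real.log (partitionFn β (dWaveSourceTorus L 0 μ 0)).re / (β * (L : ℝ) ^ 2)) +
        2 * |U| + 2 * Real.log 2 / β) / (2 * h) := by
  have hL := cast_sq_pos_of_neZero L
  have h1 := dWaveSourceDensity_le_energyDrop_div (L := L) U μ hh
  have h2 := groundEnergy_dWaveSourceTorus_le (L := L) U μ h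
  have h3 := groundEnergy_drop_le_pressureGain (L := L) U μ h hβ
  have h4 := sourcedGain_le_free_add L U μ (2 * h) hβ
  refine h1.trans ?_
  rw [div_le_div_iff₀ (by positivity) (by positivity)]
  -- (E(h) - E(2h)) * (2h) ≤ (...) * (2 h L²)
  have h5 : (dWaveSourceTorus L U μ h).groundEnergy - (dWaveSourceTorus L U μ (2 * h)).groundEnergy ≤
      (L : ℝ) ^ 2 * ((Real.log (partitionFn β (dWaveSourceTorus L 0 μ (2 * h))).re / (β * (L : ℝ) ^ 2) -
          Real.log (partitionFn β (dWaveSourceTorus L 0 μ 0)).re / (β * (L : ℝ) ^ 2)) + 2 * |U|) +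
        2 * (L : ℝ) ^ 2 * Real.log 2 / β := by
    have : (L : ℝ) ^ 2 * (Real.log (partitionFn β (dWaveSourceTorus L U μ (2 * h))).re / (β * (L : ℝ) ^ 2) -
          Real.log (partitionFn β (dWaveSourceTorus L U μ 0)).re / (β * (L : ℝ) ^ 2)) ≤
        (L : ℝ) ^ 2 * ((Real.log (partitionFn β (dWaveSourceTorus L 0 μ (2 * h))).re / (β * (L : ℝ) ^ 2) -
          Real.log (partitionFn β (dWaveSourceTorus L 0 μ 0)).re / (β * (L : ℝ) ^ 2)) + 2 * |U|) :=
      mul_le_mul_of_nonneg_left h4 hL.le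
    linarith
  have h6 : ((L : ℝ) ^ 2 * ((Real.log (partitionFn β (dWaveSourceTorus L 0 μ (2 * h))).re / (β * (L : ℝ) ^ 2) -
          Real.log (partitionFn β (dWaveSourceTorus L 0 μ 0)).re / (β * (L : ℝ) ^ 2)) + 2 * |U|) +
        2 * (L : ℝ) ^ 2 * Real.log 2 / β) * (2 * h) =
      ((Real.log (partitionFn β (dWaveSourceTorus L 0 μ (2 * h))).re / (β * (L : ℝ) ^ 2) -
          Real.log (partitionFn β (dWaveSourceTorus L 0 μ 0)).re / (β * (L : ℝ) ^ 2)) +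
        2 * |U| + 2 * Real.log 2 / β) * (2 * h * (L : ℝ) ^ 2) := by ring
  rw [← h6]
  exact mul_le_mul_of_nonneg_right h5 (by positivity)

/-- **The Cooper–Legendre ceiling, stair by stair.** For every compact `[μ₁,μ₂] ⊂ (-4,0)` there is
`K > 0` such that for ALL real `U`, `μ ∈ [μ₁,μ₂]` and `h ∈ (0,1]`:
`F(U,μ,h) = liminf_L dWaveSourceDensity (L+1) U μ h ≤ K(1 + |log h|)h + |U|/h`.
(Free Cooper logarithm at `β = h⁻²`, `L ≥ max(3,⌈β⌉)`, plus the `|U|` pressure comparison.) -/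
theorem liminf_dWaveSourceDensity_le_stair :
    ∀ μ₁ μ₂ : ℝ, -4 < μ₁ → μ₁ ≤ μ₂ → μ₂ < 0 → ∃ K : ℝ, 0 < K ∧
      ∀ U μ h : ℝ, μ ∈ Set.Icc μ₁ μ₂ → 0 < h → h ≤ 1 →
        liminf (fun L : ℕ => dWaveSourceDensity (L + 1) U μ h) atTop ≤
          K * (1 + |Real.log h|) * h + |U| / h := by
  intro μ₁ μ₂ h4 h12 h0
  obtain ⟨C₀, hC₀, hfree⟩ := dWaveSource_free_sourcedGain_le μ₁ μ₂ h4 h12 h0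
  refine ⟨4 * C₀ + 1, by positivity, fun U μ h hμ hh hh1 => ?_⟩
  set β : ℝ := (h ^ 2)⁻¹ with hβdef
  have hβ1 : 1 ≤ β := by
    rw [hβdef, one_le_inv₀ (by positivity)]
    nlinarith
  have hβ : 0 < β := by positivity
  have hlogβ : Real.log β = 2 * |Real.log h| := by
    rw [hβdef, Real.log_inv, Real.log_pow, abs_of_nonpos (Real.log_nonpos hh.le hh1)]
    push_cast
    ring
  obtain ⟨L₀, hL₀⟩ := hfree β hβ1 μ hμ
  -- the pointwise bound, eventually in `L`
  have hev : ∀ᶠ L : ℕ in atTop, dWaveSourceDensity (L + 1) U μ h ≤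
      (4 * C₀ + 1) * (1 + |Real.log h|) * h + |U| / h := by
    filter_upwards [eventually_ge_atTop L₀] with L hL
    have hg := hL₀ (L + 1) (by omega) (2 * h)
    have hd := dWaveSourceDensity_le_freeGain (L := L + 1) U μ hh hβ
    refine hd.trans ?_
    rw [div_le_iff₀ (by positivity)]
    have hg' : Real.log (partitionFn β (dWaveSourceTorus (L + 1) 0 μ (2 * h))).re / (β * ((L + 1 : ℕ) : ℝ) ^ 2) -
          Real.log (partitionFn β (dWaveSourceTorus (L + 1) 0 μ 0)).re / (β * ((L + 1 : ℕ) : ℝ) ^ 2) ≤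
        C₀ * (1 + Real.log β) * (2 * h) ^ 2 := hg
    rw [hlogβ] at hg'
    have hβh : 2 * Real.log 2 / β = 2 * Real.log 2 * h ^ 2 := by
      rw [hβdef, div_inv_eq_mul]
    rw [hβh]
    have hlog2 : Real.log 2 ≤ 1 := by
      have := Real.log_two_lt_d9; linarith
    have ha : 0 ≤ |Real.log h| := abs_nonneg _
    have hU : 0 ≤ |U| := abs_nonneg _
    have e : ((4 * C₀ + 1) * (1 + |Real.log h|) * h + |U| / h) * (2 * h) =
        (8 * C₀ + 2) * (1 + |Real.log h|) * h ^ 2 + 2 * |U| := by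
      field_simp
      ring
    rw [e]
    nlinarith [mul_nonneg hC₀.le ha, sq_nonneg h, mul_nonneg (mul_nonneg hC₀.le ha) (sq_nonneg h),
      mul_nonneg ha (sq_nonneg h)]
  refine liminf_le_of_frequently_le hev.frequently ?_
  exact isBoundedUnder_of_eventually_ge (a := 0)
    (Eventually.of_forall fun L => dWaveSourceDensity_nonneg U μ hh.le)

/-- **The Cooper–Legendre ceiling on the order parameter.** For every compact `[μ₁,μ₂] ⊂ (-4,0)`
there is `K > 0` with `dWaveOrderParameter U μ ≤ K(1 + |log h|)h + |U|/h` for ALL real `U`,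
`μ ∈ [μ₁,μ₂]`, `h ∈ (0,1]`. -/
theorem dWaveOrderParameter_le_stair :
    ∀ μ₁ μ₂ : ℝ, -4 < μ₁ → μ₁ ≤ μ₂ → μ₂ < 0 → ∃ K : ℝ, 0 < K ∧
      ∀ U μ h : ℝ, μ ∈ Set.Icc μ₁ μ₂ → 0 < h → h ≤ 1 →
        dWaveOrderParameter U μ ≤ K * (1 + |Real.log h|) * h + |U| / h := by
  intro μ₁ μ₂ h4 h12 h0
  obtain ⟨K, hK, H⟩ := liminf_dWaveSourceDensity_le_stair μ₁ μ₂ h4 h12 h0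
  exact ⟨K, hK, fun U μ h hμ hh hh1 =>
    (dWaveOrderParameter_le_liminf U μ hh).trans (H U μ h hμ hh hh1)⟩

/-- `(1 + |log h|)·h → 0` as `h → 0⁺`. -/
theorem tendsto_one_add_abs_log_mul : Tendsto (fun h : ℝ => (1 + |Real.log h|) * h) (𝓝[>] 0) (𝓝 0) := by
  have h1 : Tendsto (fun h : ℝ => Real.log h * h) (𝓝[>] 0) (𝓝 0) := by
    have := tendsto_log_mul_rpow_nhdsGT_zero zero_lt_one
    refine this.congr' ?_
    filter_upwards [self_mem_nhdsWithin] with x hx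
    rw [Real.rpow_one]
  have h2 : Tendsto (fun h : ℝ => h) (𝓝[>] 0) (𝓝 0) := tendsto_nhdsWithin_of_tendsto_nhds tendsto_id
  have h3 : Tendsto (fun h : ℝ => |Real.log h * h|) (𝓝[>] 0) (𝓝 0) := by
    simpa using h1.abs
  have h4 : Tendsto (fun h : ℝ => h + |Real.log h * h|) (𝓝[>] 0) (𝓝 0) := by
    simpa using h2.add h3
  refine h4.congr' ?_
  filter_upwards [self_mem_nhdsWithin] with x hx
  rw [abs_mul, abs_of_pos (show (0:ℝ) < x from hx)]
  ring

/-- **The free gas has no `d`-wave order**: `dWaveOrderParameter 0 μ = 0` for every `μ ∈ (-4,0)`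
(hole-doped free band). In particular the crux's hypothesis `0 < U` cannot be weakened to `0 ≤ U`:
at `U = 0` Lean reads the floor `exp(-C/U²)` as `exp 0 = 1 > 0 = dWaveOrderParameter 0 μ`. -/
theorem dWaveOrderParameter_free_eq_zero {μ : ℝ} (h4 : -4 < μ) (h0 : μ < 0) :
    dWaveOrderParameter 0 μ = 0 := by
  obtain ⟨K, hK, H⟩ := dWaveOrderParameter_le_stair μ μ h4 le_rfl h0
  refine le_antisymm ?_ (dWaveOrderParameter_nonneg 0 μ)
  have hlim : Tendsto (fun h : ℝ => K * ((1 + |Real.log h|) * h)) (𝓝[>] 0) (𝓝 0) := by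
    simpa using tendsto_one_add_abs_log_mul.const_mul K
  refine ge_of_tendsto hlim ?_
  filter_upwards [Ioc_mem_nhdsGT zero_lt_one] with h hh
  have := H 0 μ h ⟨le_rfl, le_rfl⟩ hh.1 hh.2
  simpa [mul_assoc] using this

/-- **Square-root ceiling**: `dWaveOrderParameter U μ ≤ (K+1)(1 + |log U|)√U` for `U ∈ (0,1]`,
`μ ∈ [μ₁,μ₂]` (take `h = √U`). -/
theorem dWaveOrderParameter_le_sqrt :
    ∀ μ₁ μ₂ : ℝ, -4 < μ₁ → μ₁ ≤ μ₂ → μ₂ < 0 → ∃ K : ℝ, 0 < K ∧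
      ∀ U μ : ℝ, 0 < U → U ≤ 1 → μ ∈ Set.Icc μ₁ μ₂ →
        dWaveOrderParameter U μ ≤ K * (1 + |Real.log U|) * Real.sqrt U := by
  intro μ₁ μ₂ h4 h12 h0
  obtain ⟨K, hK, H⟩ := dWaveOrderParameter_le_stair μ₁ μ₂ h4 h12 h0
  refine ⟨K + 1, by positivity, fun U μ hU hU1 hμ => ?_⟩
  have hs : 0 < Real.sqrt U := Real.sqrt_pos.2 hU
  have hs1 : Real.sqrt U ≤ 1 := Real.sqrt_le_one.mpr hU1
  have := H U μ (Real.sqrt U) hμ hs hs1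
  have hlog : |Real.log (Real.sqrt U)| ≤ |Real.log U| := by
    rw [Real.log_sqrt hU.le, abs_div, abs_two]
    have := abs_nonneg (Real.log U)
    linarith
  have hUs : |U| / Real.sqrt U = Real.sqrt U := by
    rw [abs_of_pos hU, div_eq_iff hs.ne', Real.mul_self_sqrt hU.le]
  rw [hUs] at this
  refine this.trans ?_
  have ha : 0 ≤ |Real.log U| := abs_nonneg _
  nlinarith [mul_le_mul_of_nonneg_right hlog (mul_nonneg hK.le hs.le), mul_nonneg ha hs.le]

/-- `(1 + |log U|)·√U → 0` as `U → 0⁺`. -/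
theorem tendsto_one_add_abs_log_mul_sqrt :
    Tendsto (fun U : ℝ => (1 + |Real.log U|) * Real.sqrt U) (𝓝[>] 0) (𝓝 0) := by
  have h1 : Tendsto (fun U : ℝ => Real.log U * Real.sqrt U) (𝓝[>] 0) (𝓝 0) := by
    have := tendsto_log_mul_rpow_nhdsGT_zero (r := 1 / 2) (by norm_num)
    refine this.congr' ?_
    filter_upwards [self_mem_nhdsWithin] with x hx
    rw [Real.sqrt_eq_rpow]
  have h2 : Tendsto (fun U : ℝ => Real.sqrt U) (𝓝[>] 0) (𝓝 0) := by
    have : Tendsto (fun U : ℝ => Real.sqrt U) (𝓝 0) (𝓝 (Real.sqrt 0)) :=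
      Real.continuous_sqrt.tendsto 0
    rw [Real.sqrt_zero] at this
    exact tendsto_nhdsWithin_of_tendsto_nhds this
  have h3 : Tendsto (fun U : ℝ => |Real.log U * Real.sqrt U|) (𝓝[>] 0) (𝓝 0) := by
    simpa using h1.abs
  have h4 : Tendsto (fun U : ℝ => Real.sqrt U + |Real.log U * Real.sqrt U|) (𝓝[>] 0) (𝓝 0) := by
    simpa using h2.add h3
  refine h4.congr' ?_
  filter_upwards [self_mem_nhdsWithin] with x hx
  rw [abs_mul, abs_of_nonneg (Real.sqrt_nonneg x)]
  ring

/-- **The order parameter vanishes as `U → 0⁺`, uniformly on `μ`-compacts of `(-4,0)`**: for every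
`ε > 0` there is `U₁ > 0` with `dWaveOrderParameter U μ < ε` for all `U ∈ (0,U₁)`, `μ ∈ [μ₁,μ₂]`. -/
theorem dWaveOrderParameter_lt_of_small_coupling :
    ∀ μ₁ μ₂ : ℝ, -4 < μ₁ → μ₁ ≤ μ₂ → μ₂ < 0 → ∀ ε : ℝ, 0 < ε → ∃ U₁ : ℝ, 0 < U₁ ∧
      ∀ U μ : ℝ, 0 < U → U < U₁ → μ ∈ Set.Icc μ₁ μ₂ → dWaveOrderParameter U μ < ε := by
  intro μ₁ μ₂ h4 h12 h0 ε hε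
  obtain ⟨K, hK, H⟩ := dWaveOrderParameter_le_sqrt μ₁ μ₂ h4 h12 h0
  have hlim : Tendsto (fun U : ℝ => K * ((1 + |Real.log U|) * Real.sqrt U)) (𝓝[>] 0) (𝓝 0) := by
    simpa using tendsto_one_add_abs_log_mul_sqrt.const_mul K
  have hev : ∀ᶠ U in 𝓝[>] (0 : ℝ), K * ((1 + |Real.log U|) * Real.sqrt U) < ε :=
    hlim (Iio_mem_nhds (by simpa using hε))
  rw [Filter.Eventually, mem_nhdsGT_iff_exists_Ioo_subset] at hev
  obtain ⟨u, hu, hsub⟩ := hev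
  refine ⟨min u 1, lt_min hu one_pos, fun U μ hU hUu hμ => ?_⟩
  have hU1 : U ≤ 1 := (hUu.le.trans (min_le_right _ _))
  have hUu' : U < u := lt_of_lt_of_le hUu (min_le_left _ _)
  have h1 := H U μ hU hU1 hμ
  have h2 : K * ((1 + |Real.log U|) * Real.sqrt U) < ε := hsub ⟨hU, hUu'⟩
  rw [← mul_assoc] at h2
  exact lt_of_le_of_lt h1 h2

end Ceiling

/-! ## §D Refuted strengthenings: the `U`-dependence of the floor is load-bearing -/

/-- The crux with the floor `exp(-C/U²)` replaced by a CONSTANT `c₀ > 0`, the chemical potential being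
confined to `[μ₁,μ₂]` (for `[μ₁,μ₂] ⊂ (-4,0)` this is where the density clause `n ∈ [0.52,0.70]` puts
it at weak coupling — the hole-doped free band; cf. §E). -/
def CwChiralConstructionUniformFloorOn (μ₁ μ₂ : ℝ) : Prop :=
  ∃ U₀ : ℝ, 0 < U₀ ∧ ∃ c₀ : ℝ, 0 < c₀ ∧ ∀ U ∈ Set.Ioo (0:ℝ) U₀, ∃ δ ∈ Set.Icc (3/10 : ℝ) (12/25),
    ∃ μ ∈ Set.Icc μ₁ μ₂, DensityClause U μ δ ∧ c₀ ≤ dWaveOrderParameter U μ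

/-- **No `U`-uniform floor.** For every compact `[μ₁,μ₂] ⊂ (-4,0)` the uniform-floor variant of the
crux is FALSE: the order parameter is `O(√U log(1/U))` (§C). Any proof of the crux must produce a
floor that vanishes as `U → 0⁺` — the `exp(-C/U²)` is not cosmetic. -/
theorem cw1740_false_uniformFloorOn {μ₁ μ₂ : ℝ} (h4 : -4 < μ₁) (h12 : μ₁ ≤ μ₂) (h0 : μ₂ < 0) :
    ¬ CwChiralConstructionUniformFloorOn μ₁ μ₂ := by
  rintro ⟨U₀, hU₀, c₀, hc₀, H⟩
  obtain ⟨U₁, hU₁, hsmall⟩ := dWaveOrderParameter_lt_of_small_coupling μ₁ μ₂ h4 h12 h0 c₀ hc₀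
  set U := min U₀ U₁ / 2 with hUdef
  have hU : 0 < U := by rw [hUdef]; exact div_pos (lt_min hU₀ hU₁) two_pos
  have hUU₀ : U < U₀ := by
    have := min_le_left U₀ U₁; rw [hUdef]; linarith
  have hUU₁ : U < U₁ := by
    have := min_le_right U₀ U₁; rw [hUdef]; linarith
  obtain ⟨δ, _, μ, hμ, _, hfloor⟩ := H U ⟨hU, hUU₀⟩
  exact (hsmall U μ hU hUU₁ hμ).not_ge hfloor

/-- The crux with a POWER-LAW floor `c·U^p` in place of `exp(-C/U²)`, `μ` confined to `[μ₁,μ₂]`. -/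
def CwChiralConstructionPowerFloorOn (μ₁ μ₂ p : ℝ) : Prop :=
  ∃ U₀ : ℝ, 0 < U₀ ∧ ∃ c : ℝ, 0 < c ∧ ∀ U ∈ Set.Ioo (0:ℝ) U₀, ∃ δ ∈ Set.Icc (3/10 : ℝ) (12/25),
    ∃ μ ∈ Set.Icc μ₁ μ₂, DensityClause U μ δ ∧ c * U ^ p ≤ dWaveOrderParameter U μ

/-- `(1 + |log U|)·U^q → 0` as `U → 0⁺` for `q > 0`. -/
theorem tendsto_one_add_abs_log_mul_rpow {q : ℝ} (hq : 0 < q) :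
    Tendsto (fun U : ℝ => (1 + |Real.log U|) * U ^ q) (𝓝[>] 0) (𝓝 0) := by
  have h1 : Tendsto (fun U : ℝ => Real.log U * U ^ q) (𝓝[>] 0) (𝓝 0) :=
    tendsto_log_mul_rpow_nhdsGT_zero hq
  have h2 : Tendsto (fun U : ℝ => U ^ q) (𝓝[>] 0) (𝓝 0) := by
    have h := (Real.continuous_rpow_const hq.le).tendsto 0
    rw [Real.zero_rpow hq.ne'] at h
    exact tendsto_nhdsWithin_of_tendsto_nhds h
  have h3 : Tendsto (fun U : ℝ => |Real.log U * U ^ q|) (𝓝[>] 0) (𝓝 0) := by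
    simpa using h1.abs
  have h4 : Tendsto (fun U : ℝ => U ^ q + |Real.log U * U ^ q|) (𝓝[>] 0) (𝓝 0) := by
    simpa using h2.add h3
  refine h4.congr' ?_
  filter_upwards [self_mem_nhdsWithin] with x hx
  rw [abs_mul, abs_of_nonneg (Real.rpow_nonneg (le_of_lt hx) q)]
  ring

/-- **No power-law floor with exponent `< 1/2`.** For `[μ₁,μ₂] ⊂ (-4,0)` and `p < 1/2` the variant
with floor `c·U^p` is FALSE (`√U log(1/U) = o(U^p)`). (For `p ≥ 1/2` this file's ceiling is silent; a
second-order comparison would push the refuted range to `p < 1`.) -/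
theorem cw1740_false_powerFloorOn {μ₁ μ₂ p : ℝ} (h4 : -4 < μ₁) (h12 : μ₁ ≤ μ₂) (h0 : μ₂ < 0)
    (hp : p < 1 / 2) : ¬ CwChiralConstructionPowerFloorOn μ₁ μ₂ p := by
  rintro ⟨U₀, hU₀, c, hc, H⟩
  obtain ⟨K, hK, hK'⟩ := dWaveOrderParameter_le_sqrt μ₁ μ₂ h4 h12 h0
  -- g(U) = K (1+|log U|) U^{1/2 - p} → 0, so eventually K(1+|log U|)√U < c U^p
  have hq : 0 < 1 / 2 - p := by linarith
  have hlim : Tendsto (fun U : ℝ => K * ((1 + |Real.log U|) * U ^ (1 / 2 - p))) (𝓝[>] 0) (𝓝 0) := by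
    simpa using (tendsto_one_add_abs_log_mul_rpow hq).const_mul K
  have hev : ∀ᶠ U in 𝓝[>] (0 : ℝ), K * ((1 + |Real.log U|) * U ^ (1 / 2 - p)) < c :=
    hlim (Iio_mem_nhds hc)
  rw [Filter.Eventually, mem_nhdsGT_iff_exists_Ioo_subset] at hev
  obtain ⟨u, hu, hsub⟩ := hev
  set U := min (min U₀ u) 1 / 2 with hUdef
  have hU : 0 < U := by rw [hUdef]; exact div_pos (lt_min (lt_min hU₀ hu) one_pos) two_pos
  have hUU₀ : U < U₀ := by
    have := (min_le_left (min U₀ u) 1).trans (min_le_left U₀ u); rw [hUdef]; linarith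
  have hUu : U < u := by
    have := (min_le_left (min U₀ u) 1).trans (min_le_right U₀ u); rw [hUdef]; linarith
  have hU1 : U ≤ 1 := by
    have := min_le_right (min U₀ u) 1; rw [hUdef]; linarith
  obtain ⟨δ, _, μ, hμ, _, hfloor⟩ := H U ⟨hU, hUU₀⟩
  have h1 := hK' U μ hU hU1 hμ
  have h2 : K * ((1 + |Real.log U|) * U ^ (1 / 2 - p)) < c := hsub ⟨hU, hUu⟩
  -- multiply h2 by U^p > 0: K(1+|log U|)√U < c U^p
  have hUp : 0 < U ^ p := Real.rpow_pos_of_pos hU p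
  have h3 : K * ((1 + |Real.log U|) * U ^ (1 / 2 - p)) * U ^ p < c * U ^ p :=
    mul_lt_mul_of_pos_right h2 hUp
  have h4' : U ^ (1 / 2 - p) * U ^ p = Real.sqrt U := by
    rw [← Real.rpow_add hU, Real.sqrt_eq_rpow]
    norm_num
  have h5 : K * ((1 + |Real.log U|) * U ^ (1 / 2 - p)) * U ^ p = K * (1 + |Real.log U|) * Real.sqrt U := by
    rw [← h4']; ring
  rw [h5] at h3
  exact (lt_of_le_of_lt h1 h3).not_ge hfloor

/-! ## §F Density pinning at weak coupling (cycle 2; PROVED, sorry-free)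

The crux's density clause `n ∈ [0.52, 0.70]` forces `μ ∈ [-37/10, -1/20] ⊂ (-4, 0)` once `|U| ≤ 10⁻³`
(`density_window_pins_mu`, `cwChiralConstruction_densityClause_pins_mu`). Ingredients: concavity of
`μ ↦ E_L(U,μ)` (tracial Hellmann–Feynman), `|E_L(U,·) - E_L(0,·)| ≲ |U|L²` through `Z`, the free
`log Z = Σ_k 2log(1 + e^{-β(ε_k-μ)})` and `β → ∞`, and two lattice-point counts on `(ℤ/Lℤ)²`
(diamond `|i|+|j| ≤ 11L/25` inside `{ε ≤ -1/10}`; `{ε < -18/5}` inside a `(0.21L+2)²` square).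
With it, §G refutes strengthenings of the VERBATIM crux (μ unrestricted). -/

/-- `|log Z_β(H_L(U,μ,h)) - log Z_β(H_L(0,μ,h))| ≤ β|U|L²` (Peierls–Bogoliubov). [folklore] -/
theorem abs_log_partitionFn_interacting_sub_free_le {L : ℕ} [NeZero L] (U μ h : ℝ) {β : ℝ} (hβ : 0 < β) :
    |Real.log (partitionFn β (dWaveSourceTorus L U μ h)).re -
        Real.log (partitionFn β (dWaveSourceTorus L 0 μ h)).re| ≤ β * (|U| * (L : ℝ) ^ 2) := by
  have key := abs_log_partitionFn_sub_log_partitionFn_le (isHermitian_dWaveSourceTorus L U μ h)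
    (isHermitian_dWaveSourceTorus L 0 μ h) hβ.le
  exact key.trans (mul_le_mul_of_nonneg_left (norm_dWaveSourceTorus_sub_free_le L U μ h) hβ.le)

/-! ### §F.1 Scalar inequalities for `ψ(a) = log(1 + e^{βa})` -/

section Scalar

/-- `log(1 + e^{x})` is monotone. -/
theorem log_one_add_exp_mono {x y : ℝ} (h : x ≤ y) :
    Real.log (1 + Real.exp x) ≤ Real.log (1 + Real.exp y) :=
  Real.log_le_log (by positivity) (by linarith [Real.exp_le_exp.2 h])

/-- `x ≤ log(1 + e^{x})`. -/
theorem le_log_one_add_exp (x : ℝ) : x ≤ Real.log (1 + Real.exp x) := by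
  calc x = Real.log (Real.exp x) := (Real.log_exp x).symm
    _ ≤ Real.log (1 + Real.exp x) := Real.log_le_log (Real.exp_pos x) (by linarith [Real.exp_pos x])

/-- For `x ≥ 0`: `log(1 + e^{x}) ≤ x + log 2`. -/
theorem log_one_add_exp_le {x : ℝ} (hx : 0 ≤ x) : Real.log (1 + Real.exp x) ≤ x + Real.log 2 := by
  have h1 : 1 ≤ Real.exp x := Real.one_le_exp hx
  calc Real.log (1 + Real.exp x) ≤ Real.log (2 * Real.exp x) :=
        Real.log_le_log (by positivity) (by linarith)
    _ = x + Real.log 2 := by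
        rw [Real.log_mul two_ne_zero (Real.exp_pos x).ne', Real.log_exp]; ring

/-- Lipschitz: `log(1 + e^{x + t}) ≤ log(1 + e^{x}) + t` for `t ≥ 0`. -/
theorem log_one_add_exp_add_le {x t : ℝ} (ht : 0 ≤ t) :
    Real.log (1 + Real.exp (x + t)) ≤ Real.log (1 + Real.exp x) + t := by
  have h1 : 1 ≤ Real.exp t := Real.one_le_exp ht
  calc Real.log (1 + Real.exp (x + t)) ≤ Real.log (Real.exp t * (1 + Real.exp x)) := by
        refine Real.log_le_log (by positivity) ?_
        rw [Real.exp_add]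
        nlinarith [Real.exp_pos x, Real.exp_pos t]
    _ = Real.log (1 + Real.exp x) + t := by
        rw [Real.log_mul (Real.exp_pos t).ne' (by positivity), Real.log_exp]; ring

/-- For `x ≤ 0`: `log(1 + e^{x}) ≤ e^{x} ≤ 1`. -/
theorem log_one_add_exp_le_exp (x : ℝ) : Real.log (1 + Real.exp x) ≤ Real.exp x := by
  have := Real.log_le_sub_one_of_pos (show 0 < 1 + Real.exp x by positivity)
  linarith

end Scalar

/-! ### §F.2 Trigonometry: the diamond `|a| + |b| ≤ π - d` and the cap `cos θ > 0.8` -/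

section Trig

open Real

/-- On the diamond `|a| + |b| ≤ π - d` (`0 ≤ d ≤ π`): `cos a + cos b ≥ 1 - cos d`. -/
theorem one_sub_cos_le_cos_add_cos {a b d : ℝ} (hd0 : 0 ≤ d) (hdπ : d ≤ π)
    (h : |a| + |b| ≤ π - d) : 1 - Real.cos d ≤ Real.cos a + Real.cos b := by
  -- reduce to `x = |a|, y = |b| ≥ 0`
  rw [← Real.cos_abs a, ← Real.cos_abs b]
  set x := |a| with hx
  set y := |b| with hy
  have hx0 : 0 ≤ x := abs_nonneg a
  have hy0 : 0 ≤ y := abs_nonneg b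
  have hsum : x + y ≤ π - d := h
  rw [Real.cos_add_cos]
  -- `cos((x-y)/2) ≥ cos((x+y)/2) ≥ 0`
  have h1 : 0 ≤ (x + y) / 2 := by linarith
  have h2 : (x + y) / 2 ≤ π / 2 := by linarith
  have hc1 : 0 ≤ Real.cos ((x + y) / 2) := Real.cos_nonneg_of_mem_Icc ⟨by linarith, h2⟩
  have hc2 : Real.cos ((x + y) / 2) ≤ Real.cos ((x - y) / 2) := by
    rw [← Real.cos_abs ((x - y) / 2)]
    refine Real.cos_le_cos_of_nonneg_of_le_pi (abs_nonneg _) (by linarith) ?_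
    rw [abs_div, abs_two]
    have : |x - y| ≤ x + y := abs_sub_le_of_nonneg_of_le' hx0 hy0
    linarith
  -- `2 cos²((x+y)/2) = 1 + cos(x+y) ≥ 1 + cos(π - d) = 1 - cos d`
  have h3 : 2 * Real.cos ((x + y) / 2) * Real.cos ((x + y) / 2) = 1 + Real.cos (x + y) := by
    have := Real.cos_sq ((x + y) / 2)
    rw [show 2 * ((x + y) / 2) = x + y by ring] at this
    nlinarith [this]
  have h4 : Real.cos (π - d) ≤ Real.cos (x + y) :=
    Real.cos_le_cos_of_nonneg_of_le_pi (by linarith) (by linarith) hsum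
  rw [Real.cos_pi_sub] at h4
  nlinarith [mul_le_mul_of_nonneg_left hc2 (mul_nonneg zero_le_two hc1)]
where
  /-- `|x - y| ≤ x + y` for `x, y ≥ 0`. -/
  abs_sub_le_of_nonneg_of_le' {x y : ℝ} (hx : 0 ≤ x) (hy : 0 ≤ y) : |x - y| ≤ x + y := by
    rw [abs_le]; constructor <;> linarith

/-- `cos(1/3) ≤ 0.95`, hence `1 - cos(1/3) ≥ 1/20`. -/
theorem one_sub_cos_third : (1 : ℝ) / 20 ≤ 1 - Real.cos (1 / 3) := by
  have h := Real.cos_bound (x := 1 / 3) (by rw [abs_le]; constructor <;> norm_num)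
  rw [abs_le] at h
  have h2 := h.2
  have : |(1:ℝ) / 3| = 1 / 3 := abs_of_pos (by norm_num)
  rw [this] at h2
  nlinarith [h2]

/-- `cos(13/20) ≤ 4/5`. -/
theorem cos_cap_le : Real.cos (13 / 20) ≤ (4 : ℝ) / 5 := by
  have h := Real.cos_bound (x := 13 / 20) (by rw [abs_le]; constructor <;> norm_num)
  rw [abs_le] at h
  have h2 := h.2
  have : |(13:ℝ) / 20| = 13 / 20 := abs_of_pos (by norm_num)
  rw [this] at h2
  nlinarith [h2]

/-- **Cap lemma.** If `cos θ > 4/5` then `θ < 13/20` or `2π - 13/20 < θ`. -/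
theorem angle_small_of_cos_gt {θ : ℝ} (hc : (4 : ℝ) / 5 < Real.cos θ) :
    θ < 13 / 20 ∨ 2 * π - 13 / 20 < θ := by
  rcases lt_or_ge θ (13 / 20) with h | h1
  · exact Or.inl h
  rcases lt_or_ge (2 * π - 13 / 20) θ with h | h2
  · exact Or.inr h
  exfalso
  have hπ := Real.pi_gt_three
  rcases le_or_gt θ π with hle | hgt
  · have := Real.cos_le_cos_of_nonneg_of_le_pi (by norm_num) hle h1
    linarith [cos_cap_le]
  · have h3 : Real.cos θ = Real.cos (2 * π - θ) := by
      rw [Real.cos_two_pi_sub]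
    have h4 : Real.cos (2 * π - θ) ≤ Real.cos (13 / 20) :=
      Real.cos_le_cos_of_nonneg_of_le_pi (by norm_num) (by linarith) (by linarith)
    linarith [cos_cap_le]

end Trig

/-! ### §F.3 Angles of integer representatives -/

section Angles

variable {L : ℕ} [NeZero L]

/-- `cos(2π·((i : ZMod L).val)/L) = cos(2π i/L)` for every integer `i`. -/
theorem cos_angle_intCast (i : ℤ) :
    Real.cos (2 * Real.pi * (((i : ZMod L).val : ℕ) : ℝ) / L) = Real.cos (2 * Real.pi * (i : ℝ) / L) := by
  have hL : (L : ℝ) ≠ 0 := by exact_mod_cast NeZero.ne L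
  have hv : (((i : ZMod L).val : ℕ) : ℤ) = i % (L : ℤ) := ZMod.val_intCast i
  have hdiv : i % (L : ℤ) = i - (L : ℤ) * (i / (L : ℤ)) := by rw [Int.emod_def]
  have hcast : (((i : ZMod L).val : ℕ) : ℝ) = (i : ℝ) - (L : ℝ) * ((i / (L : ℤ) : ℤ) : ℝ) := by
    have : (((i : ZMod L).val : ℕ) : ℝ) = (((((i : ZMod L).val : ℕ) : ℤ)) : ℝ) := by push_cast; rfl
    rw [this, hv, hdiv]
    push_cast
    ring
  rw [hcast]
  set q : ℤ := i / (L : ℤ)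
  have : 2 * Real.pi * ((i : ℝ) - (L : ℝ) * (q : ℝ)) / L =
      2 * Real.pi * (i : ℝ) / L - (q : ℝ) * (2 * Real.pi) := by
    have hq : 2 * Real.pi * ((i : ℝ) - (L : ℝ) * (q : ℝ)) = 2 * Real.pi * i - ((q : ℝ) * (2 * Real.pi)) * L := by
      ring
    rw [hq, sub_div, mul_div_cancel_right₀ _ hL]
  rw [this, Real.cos_sub_int_mul_two_pi]

omit [NeZero L] in
/-- Small integers are separated in `ZMod L`: `|i|, |j| ≤ m`, `2m < L`, `(i : ZMod L) = j` ⇒ `i = j`. -/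
theorem intCast_injOn_small {m : ℕ} (hm : 2 * m < L) {i j : ℤ} (hi : |i| ≤ m) (hj : |j| ≤ m)
    (h : (i : ZMod L) = (j : ZMod L)) : i = j := by
  rw [ZMod.intCast_eq_intCast_iff_dvd_sub] at h
  have hlt : (j - i).natAbs < (L : ℤ).natAbs := by
    rw [Int.natAbs_natCast]
    have : |j - i| ≤ 2 * m := by
      have := abs_sub j i
      rw [abs_le] at hi hj ⊢
      constructor <;> linarith [hi.1, hi.2, hj.1, hj.2]
    have h2 : ((j - i).natAbs : ℤ) ≤ 2 * m := by
      rw [Int.natCast_natAbs]; exact this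
    omega
  have := Int.eq_zero_of_dvd_of_natAbs_lt_natAbs h hlt
  omega

end Angles

/-! ### §F.4 Lattice-point counts on the torus `(ℤ/Lℤ)²` -/

section Counts

variable {L : ℕ} [NeZero L]

/-- `|a| + |b| ≤ c` from the four sign combinations. -/
theorem abs_add_abs_le_of_four {a b c : ℝ} (h1 : a + b ≤ c) (h2 : a - b ≤ c) (h3 : -a + b ≤ c)
    (h4 : -a - b ≤ c) : |a| + |b| ≤ c := by
  rcases abs_cases a with ⟨ha, _⟩ | ⟨ha, _⟩ <;> rcases abs_cases b with ⟨hb, _⟩ | ⟨hb, _⟩ <;>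
    rw [ha, hb] <;> linarith

/-- A torus momentum with small integer coordinates `(i, j)`, `|i| + |j| ≤ m`, `2πm/L ≤ π - 1/3`, lies
deep in the hole-doped half of the band: `ε_L(k) ≤ -1/10`. -/
theorem torusBand_le_of_small (m : ℕ) (hangle : 2 * Real.pi * m / L ≤ Real.pi - 1 / 3) {i j : ℤ}
    (hij : |(i : ℝ)| + |(j : ℝ)| ≤ m) (k : TorusSite 2 L) (h0 : k 0 = (i : ZMod L))
    (h1 : k 1 = (j : ZMod L)) : torusBand L k ≤ -(1 : ℝ) / 10 := by
  have hL : (0 : ℝ) < L := by exact_mod_cast Nat.pos_of_ne_zero (NeZero.ne L)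
  rw [torusBand_two_eq, h0, h1, cos_angle_intCast, cos_angle_intCast]
  have hd : |2 * Real.pi * (i : ℝ) / L| + |2 * Real.pi * (j : ℝ) / L| ≤ Real.pi - 1 / 3 := by
    have hπ : 0 < 2 * Real.pi / L := by positivity
    rw [show 2 * Real.pi * (i : ℝ) / L = (2 * Real.pi / L) * i by ring,
      show 2 * Real.pi * (j : ℝ) / L = (2 * Real.pi / L) * j by ring, abs_mul, abs_mul,
      abs_of_pos hπ, ← mul_add]
    calc 2 * Real.pi / L * (|(i : ℝ)| + |(j : ℝ)|) ≤ 2 * Real.pi / L * m :=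
          mul_le_mul_of_nonneg_left hij hπ.le
      _ = 2 * Real.pi * m / L := by ring
      _ ≤ Real.pi - 1 / 3 := hangle
  have hπ3 := Real.pi_gt_three
  have key := one_sub_cos_le_cos_add_cos (by norm_num) (by linarith) hd
  have num := one_sub_cos_third
  linarith

/-- **Lower count.** If `2m < L` and `2πm/L ≤ π - 1/3` then at least `(m+1)² + m²` torus momenta
have `ε_L(k) ≤ -1/10` (the lattice points of the diamond `|i| + |j| ≤ m`, split by parity of `i + j`
into two rotated square grids). -/
theorem card_filter_torusBand_le_ge (m : ℕ) (hm : 2 * m < L)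
    (hangle : 2 * Real.pi * m / L ≤ Real.pi - 1 / 3) :
    (m + 1) ^ 2 + m ^ 2 ≤
      (Finset.univ.filter fun k : TorusSite 2 L => torusBand L k ≤ -(1 : ℝ) / 10).card := by
  classical
  -- the parametrisation of the diamond
  let f : (Fin (m + 1) × Fin (m + 1)) ⊕ (Fin m × Fin m) → TorusSite 2 L := fun p =>
    match p with
    | Sum.inl (u, v) => ![(((u : ℤ) - v : ℤ) : ZMod L), (((u : ℤ) + v - m : ℤ) : ZMod L)]
    | Sum.inr (u, v) => ![(((u : ℤ) - v : ℤ) : ZMod L), (((u : ℤ) + v - m + 1 : ℤ) : ZMod L)]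
  have hcard : (Finset.univ : Finset ((Fin (m + 1) × Fin (m + 1)) ⊕ (Fin m × Fin m))).card =
      (m + 1) ^ 2 + m ^ 2 := by
    rw [Finset.card_univ, Fintype.card_sum, Fintype.card_prod, Fintype.card_prod, Fintype.card_fin,
      Fintype.card_fin]
    ring
  rw [← hcard]
  refine Finset.card_le_card_of_injOn f (fun p _ => ?_) ?_
  · -- lands in the set
    rw [Finset.coe_filter]
    refine ⟨Finset.mem_univ _, ?_⟩
    rcases p with ⟨u, v⟩ | ⟨u, v⟩
    · refine torusBand_le_of_small m hangle (i := (u : ℤ) - v) (j := (u : ℤ) + v - m) ?_ (f (Sum.inl (u, v)))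
        (by simp [f]) (by simp [f])
      have hu := u.isLt; have hv := v.isLt
      push_cast
      refine abs_add_abs_le_of_four ?_ ?_ ?_ ?_ <;>
      · have h1 : ((u : ℕ) : ℝ) ≤ m := by exact_mod_cast Nat.lt_succ_iff.mp hu
        have h2 : ((v : ℕ) : ℝ) ≤ m := by exact_mod_cast Nat.lt_succ_iff.mp hv
        have h3 : (0 : ℝ) ≤ (u : ℕ) := Nat.cast_nonneg _
        have h4 : (0 : ℝ) ≤ (v : ℕ) := Nat.cast_nonneg _
        linarith
    · refine torusBand_le_of_small m hangle (i := (u : ℤ) - v) (j := (u : ℤ) + v - m + 1) ?_ (f (Sum.inr (u, v)))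
        (by simp [f]) (by simp [f])
      have hu := u.isLt; have hv := v.isLt
      push_cast
      refine abs_add_abs_le_of_four ?_ ?_ ?_ ?_ <;>
      · have h1 : ((u : ℕ) : ℝ) + 1 ≤ m := by exact_mod_cast hu
        have h2 : ((v : ℕ) : ℝ) + 1 ≤ m := by exact_mod_cast hv
        have h3 : (0 : ℝ) ≤ (u : ℕ) := Nat.cast_nonneg _
        have h4 : (0 : ℝ) ≤ (v : ℕ) := Nat.cast_nonneg _
        linarith
  · -- injective
    intro p _ p' _ hpp
    have h0 : f p 0 = f p' 0 := by rw [hpp]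
    have h1 : f p 1 = f p' 1 := by rw [hpp]
    -- integer coordinates and their sizes
    have absle : ∀ (i : ℤ), -(m : ℤ) ≤ i → i ≤ m → |i| ≤ m := fun i ha hb => abs_le.2 ⟨ha, hb⟩
    rcases p with ⟨u, v⟩ | ⟨u, v⟩ <;> rcases p' with ⟨u', v'⟩ | ⟨u', v'⟩ <;>
      simp only [f, Matrix.cons_val_zero, Matrix.cons_val_one] at h0 h1
    · have hu := u.isLt; have hv := v.isLt; have hu' := u'.isLt; have hv' := v'.isLt
      have e0 := intCast_injOn_small hm (absle _ (by omega) (by omega)) (absle _ (by omega) (by omega)) h0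
      have e1 := intCast_injOn_small hm (absle _ (by omega) (by omega)) (absle _ (by omega) (by omega)) h1
      have : (u : ℕ) = u' ∧ (v : ℕ) = v' := by omega
      exact congrArg Sum.inl (Prod.ext (Fin.ext this.1) (Fin.ext this.2))
    · have hu := u.isLt; have hv := v.isLt; have hu' := u'.isLt; have hv' := v'.isLt
      have e0 := intCast_injOn_small hm (absle _ (by omega) (by omega)) (absle _ (by omega) (by omega)) h0
      have e1 := intCast_injOn_small hm (absle _ (by omega) (by omega)) (absle _ (by omega) (by omega)) h1
      exfalso; omega
    · have hu := u.isLt; have hv := v.isLt; have hu' := u'.isLt; have hv' := v'.isLt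
      have e0 := intCast_injOn_small hm (absle _ (by omega) (by omega)) (absle _ (by omega) (by omega)) h0
      have e1 := intCast_injOn_small hm (absle _ (by omega) (by omega)) (absle _ (by omega) (by omega)) h1
      exfalso; omega
    · have hu := u.isLt; have hv := v.isLt; have hu' := u'.isLt; have hv' := v'.isLt
      have e0 := intCast_injOn_small hm (absle _ (by omega) (by omega)) (absle _ (by omega) (by omega)) h0
      have e1 := intCast_injOn_small hm (absle _ (by omega) (by omega)) (absle _ (by omega) (by omega)) h1
      have : (u : ℕ) = u' ∧ (v : ℕ) = v' := by omega
      exact congrArg Sum.inr (Prod.ext (Fin.ext this.1) (Fin.ext this.2))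

/-- **Cap count in one direction.** The residues `a ∈ ℤ/Lℤ` with `cos(2πa/L) > 4/5` number at most
`2(13L/(40π) + 1)`: their angles lie in `[0, 13/20)` or `(2π - 13/20, 2π)`. -/
theorem card_filter_cos_gt_le :
    ((Finset.univ.filter fun a : ZMod L => (4 : ℝ) / 5 < Real.cos (2 * Real.pi * (a.val : ℝ) / L)).card : ℝ) ≤
      2 * (13 * L / (40 * Real.pi) + 1) := by
  classical
  have hL : (0 : ℝ) < L := by exact_mod_cast Nat.pos_of_ne_zero (NeZero.ne L)
  have hπ := Real.pi_pos
  set D : ℝ := 13 * L / (40 * Real.pi) with hD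
  have hD0 : 0 ≤ D := by positivity
  -- split by the two arcs
  set S := Finset.univ.filter fun a : ZMod L => (4 : ℝ) / 5 < Real.cos (2 * Real.pi * (a.val : ℝ) / L)
  set S₁ := S.filter fun a : ZMod L => 2 * Real.pi * (a.val : ℝ) / L < 13 / 20
  set S₂ := S.filter fun a : ZMod L => ¬ (2 * Real.pi * (a.val : ℝ) / L < 13 / 20)
  have hsplit : S.card = S₁.card + S₂.card := (Finset.card_filter_add_card_filter_not _).symm
  -- each arc, mapped to `ℕ` by `val`, has pairwise differences `< D`
  have key : ∀ T : Finset (ZMod L), (∀ a ∈ T, ∀ b ∈ T, ((b.val : ℕ) : ℝ) - (a.val : ℕ) < D) →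
      (T.card : ℝ) ≤ D + 1 := by
    intro T hT
    have hc : (T.image ZMod.val).card = T.card :=
      Finset.card_image_of_injective _ (ZMod.val_injective L)
    rw [← hc]
    refine card_le_of_forall_sub_lt hD0 fun a ha b hb => ?_
    obtain ⟨a', ha', rfl⟩ := Finset.mem_image.1 ha
    obtain ⟨b', hb', rfl⟩ := Finset.mem_image.1 hb
    exact hT a' ha' b' hb'
  have angle_eq : ∀ a : ZMod L, ((a.val : ℕ) : ℝ) = (2 * Real.pi * (a.val : ℝ) / L) * (L / (2 * Real.pi)) := by
    intro a; field_simp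
  have h1 : (S₁.card : ℝ) ≤ D + 1 := by
    refine key S₁ fun a ha b hb => ?_
    have ha' := (Finset.mem_filter.1 ha).2
    have hb' := (Finset.mem_filter.1 hb).2
    have hb0 : 0 ≤ 2 * Real.pi * (a.val : ℝ) / L := by positivity
    rw [angle_eq a, angle_eq b, ← sub_mul]
    calc (2 * Real.pi * (b.val : ℝ) / L - 2 * Real.pi * (a.val : ℝ) / L) * (L / (2 * Real.pi))
        < 13 / 20 * (L / (2 * Real.pi)) := by
          refine mul_lt_mul_of_pos_right ?_ (by positivity); linarith
      _ = D := by rw [hD]; field_simp; ring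
  have h2 : (S₂.card : ℝ) ≤ D + 1 := by
    refine key S₂ fun a ha b hb => ?_
    have ha' := Finset.mem_filter.1 ha
    have hb' := Finset.mem_filter.1 hb
    have haS := (Finset.mem_filter.1 ha'.1).2
    have hbS := (Finset.mem_filter.1 hb'.1).2
    -- both angles are in the upper arc `(2π - 13/20, 2π)`
    have hau : 2 * Real.pi - 13 / 20 < 2 * Real.pi * (a.val : ℝ) / L :=
      (angle_small_of_cos_gt haS).resolve_left ha'.2
    have hbl : 2 * Real.pi * (b.val : ℝ) / L ≤ 2 * Real.pi := (angle_mem_Icc b).2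
    rw [angle_eq a, angle_eq b, ← sub_mul]
    calc (2 * Real.pi * (b.val : ℝ) / L - 2 * Real.pi * (a.val : ℝ) / L) * (L / (2 * Real.pi))
        < 13 / 20 * (L / (2 * Real.pi)) := by
          refine mul_lt_mul_of_pos_right ?_ (by positivity); linarith
      _ = D := by rw [hD]; field_simp; ring
  calc (S.card : ℝ) = S₁.card + S₂.card := by rw [hsplit]; push_cast; ring
    _ ≤ (D + 1) + (D + 1) := add_le_add h1 h2
    _ = 2 * (13 * L / (40 * Real.pi) + 1) := by rw [hD]; ring

/-- **Upper count.** The torus momenta with `ε_L(k) < -18/5` have both cosines `> 4/5`, hence number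
at most `(2(13L/(40π) + 1))²`. -/
theorem card_filter_torusBand_lt_le :
    ((Finset.univ.filter fun k : TorusSite 2 L => torusBand L k < -(18 : ℝ) / 5).card : ℝ) ≤
      (2 * (13 * L / (40 * Real.pi) + 1)) ^ 2 := by
  classical
  set S := Finset.univ.filter fun a : ZMod L => (4 : ℝ) / 5 < Real.cos (2 * Real.pi * (a.val : ℝ) / L)
  have hsub : ∀ k ∈ (Finset.univ.filter fun k : TorusSite 2 L => torusBand L k < -(18 : ℝ) / 5),
      (k 0, k 1) ∈ S ×ˢ S := by
    intro k hk
    have hk' := (Finset.mem_filter.1 hk).2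
    rw [torusBand_two_eq] at hk'
    have c0 := Real.cos_le_one (2 * Real.pi * ((k 0).val : ℝ) / L)
    have c1 := Real.cos_le_one (2 * Real.pi * ((k 1).val : ℝ) / L)
    rw [Finset.mem_product]
    constructor <;> (rw [Finset.mem_filter]; refine ⟨Finset.mem_univ _, ?_⟩; linarith)
  have hinj : Set.InjOn (fun k : TorusSite 2 L => (k 0, k 1))
      ↑(Finset.univ.filter fun k : TorusSite 2 L => torusBand L k < -(18 : ℝ) / 5) := by
    intro k _ k' _ h
    simp only [Prod.mk.injEq] at h
    funext i
    fin_cases i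
    · exact h.1
    · exact h.2
  have hle := Finset.card_le_card_of_injOn (fun k : TorusSite 2 L => (k 0, k 1)) hsub hinj
  rw [Finset.card_product] at hle
  have hS := card_filter_cos_gt_le (L := L)
  have hS0 : (0 : ℝ) ≤ S.card := Nat.cast_nonneg _
  calc ((Finset.univ.filter fun k : TorusSite 2 L => torusBand L k < -(18 : ℝ) / 5).card : ℝ)
      ≤ (S.card : ℝ) * S.card := by exact_mod_cast hle
    _ ≤ (2 * (13 * L / (40 * Real.pi) + 1)) * (2 * (13 * L / (40 * Real.pi) + 1)) :=
        mul_le_mul hS hS hS0 (hS0.trans hS)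
    _ = (2 * (13 * L / (40 * Real.pi) + 1)) ^ 2 := by ring

end Counts

/-! ### §F.5 The free grand-canonical torus: `log Z` in closed form and its `μ`-differences -/

section FreeGas

variable {L : ℕ} [NeZero L]

/-- Per-mode factor at zero source: `e^{-y}(1 + cosh|y|… )/2 = (1 + e^{-y})²/4`, in logarithmic form. -/
theorem log_bdgFactor_zero (β ξ g : ℝ) :
    Real.log (Real.exp (-(β * ξ)) *
        ((1 + Real.cosh (β * Real.sqrt (ξ ^ 2 + (2 * Real.sqrt 2 * 0 * g) ^ 2))) / 2)) =
      2 * Real.log (1 + Real.exp (-(β * ξ))) - Real.log 4 := by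
  have hcosh : Real.cosh (β * Real.sqrt (ξ ^ 2 + (2 * Real.sqrt 2 * 0 * g) ^ 2)) = Real.cosh (β * ξ) := by
    rw [mul_zero, zero_mul, zero_pow two_ne_zero, add_zero, Real.sqrt_sq_eq_abs]
    rcases abs_choice ξ with h | h
    · rw [h]
    · rw [h, mul_neg, Real.cosh_neg]
  rw [hcosh, Real.cosh_eq]
  set e := Real.exp (-(β * ξ)) with he
  have he' : Real.exp (β * ξ) = e⁻¹ := by rw [he, Real.exp_neg, inv_inv]
  have hepos : 0 < e := Real.exp_pos _
  have key : e * ((1 + (e⁻¹ + e) / 2) / 2) = (1 + e) ^ 2 / 4 := by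
    field_simp
    ring
  rw [he', key, Real.log_div (by positivity) (by norm_num), Real.log_pow]
  push_cast
  ring

/-- **The free grand-canonical `log Z`** (`L ≥ 3`): `log Tr e^{-β(H(1,0) - μN)} = Σ_k 2 log(1 + e^{-β(ε_L(k) - μ)})`
(free fermions, two spin states per momentum). [folklore] -/
theorem log_partitionFn_free_eq (hL : 3 ≤ L) (β μ : ℝ) :
    Real.log (partitionFn β (dWaveSourceTorus L 0 μ 0)).re =
      ∑ k : TorusSite 2 L, 2 * Real.log (1 + Real.exp (-(β * (torusBand L k - μ)))) := by
  rw [partitionFn_dWaveSourceTorus_zero_re hL]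
  have hpow : (0 : ℝ) < (2 : ℝ) ^ Fintype.card (Orb (FermionTorus 2 L)) := by positivity
  have hfac : ∀ k : TorusSite 2 L, Real.exp (-(β * (torusBand L k - μ))) *
      ((1 + Real.cosh (β * Real.sqrt ((torusBand L k - μ) ^ 2 + (2 * Real.sqrt 2 * 0 * dWaveGap k) ^ 2))) / 2) ≠ 0 :=
    fun k => (bdgModeFactor_pos β _ _).ne'
  rw [Real.log_mul hpow.ne' (Finset.prod_ne_zero_iff.2 fun k _ => hfac k),
    Real.log_prod (s := Finset.univ) (hf := fun k _ => hfac k), Real.log_pow, card_orb_fermionTorus_two]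
  simp_rw [log_bdgFactor_zero]
  rw [Finset.sum_sub_distrib, Finset.sum_const, Finset.card_univ]
  have hcard : Fintype.card (TorusSite 2 L) = L ^ 2 := by
    simp [TorusSite, ZMod.card]
  rw [hcard, nsmul_eq_mul, show (4 : ℝ) = 2 ^ 2 by norm_num, Real.log_pow]
  push_cast
  ring

/-- **Lower `μ`-difference of the free `log Z`.** For `β > 0`, `η ≥ 0`, `L ≥ 3`:
`log Z₀(μ) - log Z₀(μ - η) ≥ 2(βη - log 2)·#{k : ε_L(k) ≤ μ - η}`. [folklore] -/
theorem logZ_free_sub_ge (hL : 3 ≤ L) {β η : ℝ} (hβ : 0 < β) (hη : 0 ≤ η) (μ : ℝ) :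
    2 * (β * η - Real.log 2) * ((Finset.univ.filter fun k : TorusSite 2 L => torusBand L k ≤ μ - η).card : ℝ) ≤
      Real.log (partitionFn β (dWaveSourceTorus L 0 μ 0)).re -
        Real.log (partitionFn β (dWaveSourceTorus L 0 (μ - η) 0)).re := by
  rw [log_partitionFn_free_eq hL, log_partitionFn_free_eq hL, ← Finset.sum_sub_distrib]
  set F : TorusSite 2 L → ℝ := fun k => 2 * Real.log (1 + Real.exp (-(β * (torusBand L k - μ)))) -
      2 * Real.log (1 + Real.exp (-(β * (torusBand L k - (μ - η)))))
  have hF0 : ∀ k, 0 ≤ F k := fun k => by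
    have := log_one_add_exp_mono (x := -(β * (torusBand L k - (μ - η)))) (y := -(β * (torusBand L k - μ)))
      (by nlinarith)
    simp only [F]; linarith
  have hF1 : ∀ k ∈ (Finset.univ.filter fun k : TorusSite 2 L => torusBand L k ≤ μ - η),
      2 * (β * η - Real.log 2) ≤ F k := by
    intro k hk
    have hk' := (Finset.mem_filter.1 hk).2
    have h1 := le_log_one_add_exp (-(β * (torusBand L k - μ)))
    have h2 := log_one_add_exp_le (x := -(β * (torusBand L k - (μ - η)))) (by nlinarith)
    simp only [F]
    nlinarith
  calc 2 * (β * η - Real.log 2) * ((Finset.univ.filter fun k : TorusSite 2 L => torusBand L k ≤ μ - η).card : ℝ)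
      = ∑ _k ∈ (Finset.univ.filter fun k : TorusSite 2 L => torusBand L k ≤ μ - η), 2 * (β * η - Real.log 2) := by
        rw [Finset.sum_const, nsmul_eq_mul]; ring
    _ ≤ ∑ k ∈ (Finset.univ.filter fun k : TorusSite 2 L => torusBand L k ≤ μ - η), F k :=
        Finset.sum_le_sum hF1
    _ ≤ ∑ k, F k :=
        Finset.sum_le_sum_of_subset_of_nonneg (Finset.filter_subset _ _) fun k _ _ => hF0 k

/-- **Upper `μ`-difference of the free `log Z`.** For `β > 0`, `η ≥ 0`, `L ≥ 3`:
`log Z₀(μ + η) - log Z₀(μ) ≤ 2βη·#{k : ε_L(k) < μ + 2η} + 2e^{-βη}·L²`. [folklore] -/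
theorem logZ_free_sub_le (hL : 3 ≤ L) {β η : ℝ} (hβ : 0 < β) (hη : 0 ≤ η) (μ : ℝ) :
    Real.log (partitionFn β (dWaveSourceTorus L 0 (μ + η) 0)).re -
        Real.log (partitionFn β (dWaveSourceTorus L 0 μ 0)).re ≤
      2 * (β * η) * ((Finset.univ.filter fun k : TorusSite 2 L => torusBand L k < μ + 2 * η).card : ℝ) +
        2 * Real.exp (-(β * η)) * (L : ℝ) ^ 2 := by
  classical
  rw [log_partitionFn_free_eq hL, log_partitionFn_free_eq hL, ← Finset.sum_sub_distrib]
  set F : TorusSite 2 L → ℝ := fun k => 2 * Real.log (1 + Real.exp (-(β * (torusBand L k - (μ + η))))) -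
      2 * Real.log (1 + Real.exp (-(β * (torusBand L k - μ))))
  set P : TorusSite 2 L → Prop := fun k => torusBand L k < μ + 2 * η
  have hFa : ∀ k, F k ≤ 2 * (β * η) := fun k => by
    have := log_one_add_exp_add_le (x := -(β * (torusBand L k - μ))) (t := β * η) (by positivity)
    rw [show -(β * (torusBand L k - μ)) + β * η = -(β * (torusBand L k - (μ + η))) by ring] at this
    simp only [F]; linarith
  have hFb : ∀ k, ¬ P k → F k ≤ 2 * Real.exp (-(β * η)) := fun k hk => by
    have hk' : μ + 2 * η ≤ torusBand L k := le_of_not_gt hk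
    have h1 := log_one_add_exp_le_exp (-(β * (torusBand L k - (μ + η))))
    have h2 : Real.exp (-(β * (torusBand L k - (μ + η)))) ≤ Real.exp (-(β * η)) :=
      Real.exp_le_exp.2 (by nlinarith)
    have h3 : 0 ≤ 2 * Real.log (1 + Real.exp (-(β * (torusBand L k - μ)))) := by
      have := Real.log_nonneg (show (1:ℝ) ≤ 1 + Real.exp (-(β * (torusBand L k - μ))) by
        linarith [Real.exp_pos (-(β * (torusBand L k - μ)))])
      linarith
    simp only [F]; linarith
  rw [← Finset.sum_filter_add_sum_filter_not Finset.univ P]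
  have hcardL : ((Finset.univ.filter fun k => ¬ P k).card : ℝ) ≤ (L : ℝ) ^ 2 := by
    have h1 : (Finset.univ.filter fun k => ¬ P k).card ≤ Fintype.card (TorusSite 2 L) :=
      Finset.card_filter_le _ _ |>.trans (Finset.card_univ (α := TorusSite 2 L)).le
    have hcard : Fintype.card (TorusSite 2 L) = L ^ 2 := by
      simp [TorusSite, ZMod.card]
    rw [hcard] at h1
    exact_mod_cast h1
  have hexp : 0 ≤ 2 * Real.exp (-(β * η)) := by positivity
  calc ∑ k ∈ Finset.univ.filter P, F k + ∑ k ∈ Finset.univ.filter (fun k => ¬ P k), F k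
      ≤ ∑ _k ∈ Finset.univ.filter P, 2 * (β * η) +
          ∑ _k ∈ Finset.univ.filter (fun k => ¬ P k), 2 * Real.exp (-(β * η)) :=
        add_le_add (Finset.sum_le_sum fun k _ => hFa k)
          (Finset.sum_le_sum fun k hk => hFb k (Finset.mem_filter.1 hk).2)
    _ = 2 * (β * η) * ((Finset.univ.filter P).card : ℝ) +
          2 * Real.exp (-(β * η)) * ((Finset.univ.filter fun k => ¬ P k).card : ℝ) := by
        rw [Finset.sum_const, Finset.sum_const, nsmul_eq_mul, nsmul_eq_mul]; ring
    _ ≤ 2 * (β * η) * ((Finset.univ.filter P).card : ℝ) + 2 * Real.exp (-(β * η)) * (L : ℝ) ^ 2 := by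
        have := mul_le_mul_of_nonneg_left hcardL hexp
        linarith

end FreeGas

/-! ### §F.6 The interacting grand-canonical torus: finite-volume density sandwich -/

section Density

variable {L : ℕ} [NeZero L]

omit [NeZero L] in
/-- **Concavity in `μ` (Hellmann–Feynman for the tracial ground state).** For all `μ, μ'`:
`(μ' - μ)·Re ω_{U,μ}(N) ≤ E_L(U,μ) - E_L(U,μ')`, `E_L(U,μ) = E₀(H(1,U) - μN)`. [cite: KomaTasaki1994, §1] -/
theorem sub_mul_density_le (U μ μ' : ℝ) :
    (μ' - μ) * ((hubbardTorusWith 2 L 1 U μ).groundStateFunctional totalNumber).re ≤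
      (hubbardTorusWith 2 L 1 U μ).groundEnergy - (hubbardTorusWith 2 L 1 U μ').groundEnergy := by
  have hK : (hubbardTorus 2 L 1 U).IsHermitian := by simpa using isHermitian_hubbardTorusWith L 1 U 0
  exact sub_mul_re_groundStateFunctional_le hK totalNumber_isHermitian μ μ'

/-- **Ground energy from below through the free `log Z`** (`L ≥ 3`, `β > 0`):
`-Σ_k 2log(1 + e^{-β(ε_k - μ)})/β - |U|L² ≤ E_L(U,μ)`. [folklore] -/
theorem groundEnergy_ge_free (hL : 3 ≤ L) (U μ : ℝ) {β : ℝ} (hβ : 0 < β) :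
    -(∑ k : TorusSite 2 L, 2 * Real.log (1 + Real.exp (-(β * (torusBand L k - μ))))) / β - |U| * (L : ℝ) ^ 2 ≤
      (hubbardTorusWith 2 L 1 U μ).groundEnergy := by
  rw [← dWaveSourceTorus_zero, ← log_partitionFn_free_eq hL β μ]
  have h1 := neg_log_partitionFn_div_le_groundEnergy (isHermitian_dWaveSourceTorus L U μ 0) hβ
  have h2 := abs_log_partitionFn_interacting_sub_free_le (L := L) U μ 0 hβ
  rw [abs_le] at h2
  have h3 : -Real.log (partitionFn β (dWaveSourceTorus L 0 μ 0)).re / β - |U| * (L : ℝ) ^ 2 ≤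
      -Real.log (partitionFn β (dWaveSourceTorus L U μ 0)).re / β := by
    rw [sub_le_iff_le_add, div_add' _ _ _ hβ.ne', div_le_div_iff_of_pos_right hβ]
    nlinarith [h2.2]
  exact h3.trans h1

/-- **Ground energy from above through the free `log Z`** (`L ≥ 3`, `β > 0`):
`E_L(U,μ) ≤ (2L² log 2 - Σ_k 2log(1 + e^{-β(ε_k - μ)}))/β + |U|L²`. [folklore] -/
theorem groundEnergy_le_free (hL : 3 ≤ L) (U μ : ℝ) {β : ℝ} (hβ : 0 < β) :
    (hubbardTorusWith 2 L 1 U μ).groundEnergy ≤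
      (2 * (L : ℝ) ^ 2 * Real.log 2 -
          ∑ k : TorusSite 2 L, 2 * Real.log (1 + Real.exp (-(β * (torusBand L k - μ))))) / β +
        |U| * (L : ℝ) ^ 2 := by
  rw [← dWaveSourceTorus_zero, ← log_partitionFn_free_eq hL β μ]
  have h1 := groundEnergy_le_log_card_sub_log_partitionFn_div (isHermitian_dWaveSourceTorus L U μ 0) hβ
  rw [log_card_fock] at h1
  have h2 := abs_log_partitionFn_interacting_sub_free_le (L := L) U μ 0 hβ
  rw [abs_le] at h2
  refine h1.trans ?_
  have h3 : (2 * (L : ℝ) ^ 2 * Real.log 2 - Real.log (partitionFn β (dWaveSourceTorus L U μ 0)).re) / β -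
      (2 * (L : ℝ) ^ 2 * Real.log 2 - Real.log (partitionFn β (dWaveSourceTorus L 0 μ 0)).re) / β ≤
        |U| * (L : ℝ) ^ 2 := by
    rw [div_sub_div_same, div_le_iff₀ hβ]
    nlinarith [h2.1]
  linarith

/-- **Finite-volume density from below** (`L ≥ 3`, `η > 0`):
`2η·#{k : ε_L(k) ≤ μ - η} - 2|U|L² ≤ η·Re ω_{U,μ}(N)`. [folklore] -/
theorem density_mul_ge (hL : 3 ≤ L) (U μ : ℝ) {η : ℝ} (hη : 0 < η) :
    2 * η * ((Finset.univ.filter fun k : TorusSite 2 L => torusBand L k ≤ μ - η).card : ℝ) -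
        2 * |U| * (L : ℝ) ^ 2 ≤
      η * ((hubbardTorusWith 2 L 1 U μ).groundStateFunctional totalNumber).re := by
  set N := ((Finset.univ.filter fun k : TorusSite 2 L => torusBand L k ≤ μ - η).card : ℝ) with hN
  set n := ((hubbardTorusWith 2 L 1 U μ).groundStateFunctional totalNumber).re
  have hNL : N ≤ (L : ℝ) ^ 2 := by
    have h1 : (Finset.univ.filter fun k : TorusSite 2 L => torusBand L k ≤ μ - η).card ≤
        Fintype.card (TorusSite 2 L) :=
      Finset.card_filter_le _ _ |>.trans (Finset.card_univ (α := TorusSite 2 L)).le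
    have hcard : Fintype.card (TorusSite 2 L) = L ^ 2 := by simp [TorusSite, ZMod.card]
    rw [hcard] at h1
    rw [hN]
    exact_mod_cast h1
  -- for every `β > 0`
  have key : ∀ β : ℝ, 0 < β → 2 * η * N - 2 * |U| * (L : ℝ) ^ 2 - 4 * (L : ℝ) ^ 2 * Real.log 2 / β ≤ η * n := by
    intro β hβ
    have hconc := sub_mul_density_le (L := L) U μ (μ - η)
    have hE1 := groundEnergy_ge_free hL U (μ - η) hβ
    have hE2 := groundEnergy_le_free hL U μ hβ
    have hZ := logZ_free_sub_ge hL hβ hη.le μ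
    rw [log_partitionFn_free_eq hL, log_partitionFn_free_eq hL] at hZ
    set S1 := ∑ k : TorusSite 2 L, 2 * Real.log (1 + Real.exp (-(β * (torusBand L k - μ))))
    set S2 := ∑ k : TorusSite 2 L, 2 * Real.log (1 + Real.exp (-(β * (torusBand L k - (μ - η)))))
    -- `η n ≥ E(μ-η) - E(μ) ≥ (S1 - S2)/β - 2L² log 2/β - 2|U|L²`
    have h1 : (S1 - S2) / β - 2 * (L : ℝ) ^ 2 * Real.log 2 / β - 2 * |U| * (L : ℝ) ^ 2 ≤ η * n := by
      have e : (S1 - S2) / β - 2 * (L : ℝ) ^ 2 * Real.log 2 / β =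
          -S2 / β - (2 * (L : ℝ) ^ 2 * Real.log 2 - S1) / β := by
        rw [div_sub_div_same, div_sub_div_same]
        congr 1
        ring
      have hc : μ - η - μ = -η := by ring
      rw [hc] at hconc
      linarith [hconc, hE1, hE2, e]
    have h2 : 2 * (β * η - Real.log 2) * N / β ≤ (S1 - S2) / β := div_le_div_of_nonneg_right hZ hβ.le
    have h3 : 2 * η * N - 2 * |U| * (L : ℝ) ^ 2 - 4 * (L : ℝ) ^ 2 * Real.log 2 / β ≤
        2 * (β * η - Real.log 2) * N / β - 2 * (L : ℝ) ^ 2 * Real.log 2 / β - 2 * |U| * (L : ℝ) ^ 2 := by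
      have hlog2 : 0 ≤ Real.log 2 := Real.log_nonneg one_le_two
      have e : 2 * (β * η - Real.log 2) * N / β = 2 * η * N - 2 * Real.log 2 * N / β := by
        rw [show 2 * (β * η - Real.log 2) * N = β * (2 * η * N) - 2 * Real.log 2 * N by ring, sub_div,
          mul_div_cancel_left₀ _ hβ.ne']
      rw [e]
      have : 2 * Real.log 2 * N / β ≤ 2 * (L : ℝ) ^ 2 * Real.log 2 / β :=
        div_le_div_of_nonneg_right (by nlinarith) hβ.le
      have e2 : 4 * (L : ℝ) ^ 2 * Real.log 2 / β = 2 * (L : ℝ) ^ 2 * Real.log 2 / β + 2 * (L : ℝ) ^ 2 * Real.log 2 / β := by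
        rw [← add_div]
        congr 1
        ring
      rw [e2]
      linarith
    linarith
  -- `β → ∞`
  have hlim : Tendsto (fun β : ℝ => 2 * η * N - 2 * |U| * (L : ℝ) ^ 2 - 4 * (L : ℝ) ^ 2 * Real.log 2 / β)
      atTop (𝓝 (2 * η * N - 2 * |U| * (L : ℝ) ^ 2 - 0)) :=
    tendsto_const_nhds.sub (tendsto_const_nhds.div_atTop tendsto_id)
  rw [sub_zero] at hlim
  exact le_of_tendsto hlim (by
    filter_upwards [eventually_gt_atTop (0 : ℝ)] with β hβ using key β hβ)

/-- **Finite-volume density from above** (`L ≥ 3`, `η > 0`):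
`η·Re ω_{U,μ}(N) ≤ 2η·#{k : ε_L(k) < μ + 2η} + 2|U|L²`. [folklore] -/
theorem density_mul_le (hL : 3 ≤ L) (U μ : ℝ) {η : ℝ} (hη : 0 < η) :
    η * ((hubbardTorusWith 2 L 1 U μ).groundStateFunctional totalNumber).re ≤
      2 * η * ((Finset.univ.filter fun k : TorusSite 2 L => torusBand L k < μ + 2 * η).card : ℝ) +
        2 * |U| * (L : ℝ) ^ 2 := by
  set N := ((Finset.univ.filter fun k : TorusSite 2 L => torusBand L k < μ + 2 * η).card : ℝ) with hN
  set n := ((hubbardTorusWith 2 L 1 U μ).groundStateFunctional totalNumber).re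
  have key : ∀ β : ℝ, 0 < β → η * n ≤ 2 * η * N + 2 * |U| * (L : ℝ) ^ 2 + (2 + 2 * Real.log 2) * (L : ℝ) ^ 2 / β := by
    intro β hβ
    have hconc := sub_mul_density_le (L := L) U μ (μ + η)
    have hE1 := groundEnergy_ge_free hL U (μ + η) hβ
    have hE2 := groundEnergy_le_free hL U μ hβ
    have hZ := logZ_free_sub_le hL hβ hη.le μ
    rw [log_partitionFn_free_eq hL, log_partitionFn_free_eq hL] at hZ
    set S1 := ∑ k : TorusSite 2 L, 2 * Real.log (1 + Real.exp (-(β * (torusBand L k - (μ + η)))))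
    set S2 := ∑ k : TorusSite 2 L, 2 * Real.log (1 + Real.exp (-(β * (torusBand L k - μ))))
    have h1 : η * n ≤ (S1 - S2) / β + 2 * (L : ℝ) ^ 2 * Real.log 2 / β + 2 * |U| * (L : ℝ) ^ 2 := by
      have e : (2 * (L : ℝ) ^ 2 * Real.log 2 - S2) / β - -S1 / β =
          (S1 - S2) / β + 2 * (L : ℝ) ^ 2 * Real.log 2 / β := by
        rw [div_sub_div_same, ← add_div]
        congr 1
        ring
      have hc : μ + η - μ = η := by ring
      rw [hc] at hconc
      linarith [hconc, hE1, hE2, e]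
    have h2 : (S1 - S2) / β ≤ (2 * (β * η) * N + 2 * Real.exp (-(β * η)) * (L : ℝ) ^ 2) / β :=
      div_le_div_of_nonneg_right hZ hβ.le
    have h3 : (2 * (β * η) * N + 2 * Real.exp (-(β * η)) * (L : ℝ) ^ 2) / β ≤ 2 * η * N + 2 * (L : ℝ) ^ 2 / β := by
      have hexp : Real.exp (-(β * η)) ≤ 1 := Real.exp_le_one_iff.mpr (by nlinarith)
      have e : (2 * (β * η) * N + 2 * Real.exp (-(β * η)) * (L : ℝ) ^ 2) / β =
          2 * η * N + 2 * Real.exp (-(β * η)) * (L : ℝ) ^ 2 / β := by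
        rw [add_div, show 2 * (β * η) * N = β * (2 * η * N) by ring, mul_div_cancel_left₀ _ hβ.ne']
      rw [e]
      have : 2 * Real.exp (-(β * η)) * (L : ℝ) ^ 2 / β ≤ 2 * (L : ℝ) ^ 2 / β :=
        div_le_div_of_nonneg_right (by nlinarith [sq_nonneg (L : ℝ), Real.exp_pos (-(β * η))]) hβ.le
      linarith
    have e3 : (2 + 2 * Real.log 2) * (L : ℝ) ^ 2 / β = 2 * (L : ℝ) ^ 2 / β + 2 * (L : ℝ) ^ 2 * Real.log 2 / β := by
      rw [← add_div]
      congr 1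
      ring
    rw [e3]
    linarith
  have hlim : Tendsto (fun β : ℝ => 2 * η * N + 2 * |U| * (L : ℝ) ^ 2 + (2 + 2 * Real.log 2) * (L : ℝ) ^ 2 / β)
      atTop (𝓝 (2 * η * N + 2 * |U| * (L : ℝ) ^ 2 + 0)) :=
    tendsto_const_nhds.add (tendsto_const_nhds.div_atTop tendsto_id)
  rw [add_zero] at hlim
  exact ge_of_tendsto hlim (by
    filter_upwards [eventually_gt_atTop (0 : ℝ)] with β hβ using key β hβ)

end Density

/-! ### §F.7 Large tori: density thresholds and the pinning of `μ` -/

section Pinning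

variable {L : ℕ} [NeZero L]

/-- **Deep in the band the density is large.** For `L ≥ 400`, `|U| ≤ 10⁻³` and `μ ≥ -1/20`:
`Re ω_{U,μ}(N) ≥ (18/25)·L²` (density `≥ 0.72`). [folklore] -/
theorem density_ge_of_mu_ge (hL : 400 ≤ L) {U μ : ℝ} (hU : |U| ≤ 1 / 1000) (hμ : -(1 : ℝ) / 20 ≤ μ) :
    (18 : ℝ) / 25 * (L : ℝ) ^ 2 ≤ ((hubbardTorusWith 2 L 1 U μ).groundStateFunctional totalNumber).re := by
  have hL3 : 3 ≤ L := by omega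
  have hℓ : (400 : ℝ) ≤ L := by exact_mod_cast hL
  have key := density_mul_ge hL3 U μ (η := 1 / 20) (by norm_num)
  -- the diamond count at threshold `-1/10 ≤ μ - 1/20`
  set m : ℕ := 11 * L / 25 with hm
  have hm2 : 2 * m < L := by omega
  have hm_le : (m : ℝ) ≤ 11 * L / 25 := by
    have : (m : ℝ) * 25 ≤ 11 * L := by
      have h : m * 25 ≤ 11 * L := Nat.div_mul_le_self (11 * L) 25
      exact_mod_cast h
    linarith
  have hm_ge : (11 * L - 24 : ℝ) / 25 ≤ m := by
    have : 11 * L ≤ m * 25 + 24 := by omega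
    have h' : (11 * L : ℝ) ≤ (m : ℝ) * 25 + 24 := by exact_mod_cast this
    rw [div_le_iff₀ (by norm_num : (0:ℝ) < 25)]
    linarith
  have hπ := Real.pi_gt_three
  have hLpos : (0 : ℝ) < L := by linarith
  have hangle : 2 * Real.pi * m / L ≤ Real.pi - 1 / 3 := by
    rw [div_le_iff₀ hLpos]
    nlinarith [mul_le_mul_of_nonneg_left hm_le (by positivity : (0:ℝ) ≤ 2 * Real.pi)]
  have hcount := card_filter_torusBand_le_ge (L := L) m hm2 hangle
  have hmono : (Finset.univ.filter fun k : TorusSite 2 L => torusBand L k ≤ -(1 : ℝ) / 10).card ≤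
      (Finset.univ.filter fun k : TorusSite 2 L => torusBand L k ≤ μ - 1 / 20).card := by
    refine Finset.card_le_card (Finset.monotone_filter_right _ fun k _ hk => ?_)
    exact hk.trans (by linarith)
  have hN : ((m : ℝ) + 1) ^ 2 + (m : ℝ) ^ 2 ≤
      ((Finset.univ.filter fun k : TorusSite 2 L => torusBand L k ≤ μ - 1 / 20).card : ℝ) := by
    exact_mod_cast hcount.trans hmono
  -- arithmetic: `2((m+1)² + m²) - L²/25 ≥ (18/25)L²` for `L ≥ 400`
  set a : ℝ := (m : ℝ)
  have hb0 : (0 : ℝ) ≤ (11 * L - 24) / 25 := by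
    rw [le_div_iff₀ (by norm_num : (0:ℝ) < 25)]; linarith
  have ha2 : ((11 * L - 24 : ℝ) / 25) ^ 2 ≤ a ^ 2 := pow_le_pow_left₀ hb0 hm_ge 2
  nlinarith [hN, key, ha2, hm_ge, hU, sq_nonneg (L : ℝ), mul_le_mul_of_nonneg_left hℓ hLpos.le]

/-- **Near the band bottom the density is small.** For `L ≥ 400`, `|U| ≤ 10⁻³` and `μ ≤ -37/10`:
`Re ω_{U,μ}(N) ≤ L²/2`. [folklore] -/
theorem density_le_of_mu_le (hL : 400 ≤ L) {U μ : ℝ} (hU : |U| ≤ 1 / 1000) (hμ : μ ≤ -(37 : ℝ) / 10) :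
    ((hubbardTorusWith 2 L 1 U μ).groundStateFunctional totalNumber).re ≤ (L : ℝ) ^ 2 / 2 := by
  have hL3 : 3 ≤ L := by omega
  have hℓ : (400 : ℝ) ≤ L := by exact_mod_cast hL
  have key := density_mul_le hL3 U μ (η := 1 / 20) (by norm_num)
  have hmono : (Finset.univ.filter fun k : TorusSite 2 L => torusBand L k < μ + 2 * (1 / 20)).card ≤
      (Finset.univ.filter fun k : TorusSite 2 L => torusBand L k < -(18 : ℝ) / 5).card := by
    refine Finset.card_le_card (Finset.monotone_filter_right _ fun k _ hk => ?_)
    exact lt_of_lt_of_le hk (by linarith)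
  have hcount := card_filter_torusBand_lt_le (L := L)
  have hN : ((Finset.univ.filter fun k : TorusSite 2 L => torusBand L k < μ + 2 * (1 / 20)).card : ℝ) ≤
      (2 * (13 * L / (40 * Real.pi) + 1)) ^ 2 := by
    exact (show ((Finset.univ.filter fun k : TorusSite 2 L => torusBand L k < μ + 2 * (1 / 20)).card : ℝ) ≤
      ((Finset.univ.filter fun k : TorusSite 2 L => torusBand L k < -(18 : ℝ) / 5).card : ℝ) by
        exact_mod_cast hmono).trans hcount
  have hπ := Real.pi_gt_three
  have hB : 13 * L / (40 * Real.pi) ≤ 13 * L / 120 := by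
    refine div_le_div_of_nonneg_left (by positivity) (by norm_num) (by nlinarith)
  have hB2 : (2 * (13 * L / (40 * Real.pi) + 1)) ^ 2 ≤ (2 * (13 * L / 120 + 1)) ^ 2 := by
    refine pow_le_pow_left₀ (by positivity) (by linarith) 2
  nlinarith [hN, key, hB2, hU, sq_nonneg (L : ℝ), hℓ]

/-- **Density pinning at weak coupling.** If `|U| ≤ 10⁻³` and the tracial grand-canonical ground-state
density of `hubbardTorusWith 2 (L+1) 1 U μ` tends to some `n ∈ [0.52, 0.70]`, then
`μ ∈ [-37/10, -1/20]` — a compact of the hole-doped free band `(-4, 0)`. [folklore] -/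
theorem density_window_pins_mu {U μ n : ℝ} (hU : |U| ≤ 1 / 1000) (hn : n ∈ Set.Icc ((13 : ℝ) / 25) (7 / 10))
    (hlim : Tendsto (fun L : ℕ => ((hubbardTorusWith 2 (L + 1) 1 U μ).groundStateFunctional
      totalNumber).re / ((L + 1 : ℕ) : ℝ) ^ 2) atTop (𝓝 n)) :
    μ ∈ Set.Icc (-(37 : ℝ) / 10) (-(1 : ℝ) / 20) := by
  constructor
  · rcases lt_or_ge μ (-(37 : ℝ) / 10) with h | h
    · exfalso
      have hev : ∀ᶠ L : ℕ in atTop, ((hubbardTorusWith 2 (L + 1) 1 U μ).groundStateFunctional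
          totalNumber).re / ((L + 1 : ℕ) : ℝ) ^ 2 ≤ 1 / 2 := by
        filter_upwards [eventually_ge_atTop 399] with L hL
        have hd := density_le_of_mu_le (L := L + 1) (by omega) hU h.le
        have hpos : (0 : ℝ) < (((L + 1 : ℕ) : ℝ)) ^ 2 := by positivity
        rw [div_le_iff₀ hpos]
        linarith
      have := le_of_tendsto hlim hev
      linarith [hn.1]
    · exact h
  · rcases le_or_gt μ (-(1 : ℝ) / 20) with h | h
    · exact h
    · exfalso
      have hev : ∀ᶠ L : ℕ in atTop, (18 : ℝ) / 25 ≤ ((hubbardTorusWith 2 (L + 1) 1 U μ).groundStateFunctional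
          totalNumber).re / ((L + 1 : ℕ) : ℝ) ^ 2 := by
        filter_upwards [eventually_ge_atTop 399] with L hL
        have hd := density_ge_of_mu_ge (L := L + 1) (by omega) hU h.le
        have hpos : (0 : ℝ) < (((L + 1 : ℕ) : ℝ)) ^ 2 := by positivity
        rw [le_div_iff₀ hpos]
        linarith
      have := ge_of_tendsto hlim hev
      linarith [hn.2]

/-- **The density clause of the crux pins the chemical potential.** For `|U| ≤ 10⁻³` and a doping
`δ ∈ [3/10, 12/25]`, the crux's density clause forces `μ ∈ [-37/10, -1/20] ⊂ (-4, 0)`. [folklore] -/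
theorem cwChiralConstruction_densityClause_pins_mu {U μ δ : ℝ} (hU : |U| ≤ 1 / 1000)
    (hδ : δ ∈ Set.Icc (3 / 10 : ℝ) (12 / 25))
    (hdens : Tendsto (fun L : ℕ => ((hubbardTorusWith 2 (L + 1) 1 U μ).groundStateFunctional
      totalNumber).re / ((L + 1 : ℕ) : ℝ) ^ 2) atTop (𝓝 (1 - δ))) :
    μ ∈ Set.Icc (-(37 : ℝ) / 10) (-(1 : ℝ) / 20) :=
  density_window_pins_mu hU ⟨by linarith [hδ.2], by linarith [hδ.1]⟩ hdens

end Pinning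

/-! ## §G Refuted strengthenings of the VERBATIM crux (μ unrestricted, density clause verbatim) -/

section Verbatim

/-- **No constant floor (verbatim crux).** `CwChiralConstruction` with `exp(-C/U²)` replaced by a constant
`c₀ > 0` — `μ : ℝ` unrestricted, density clause verbatim — is FALSE. [cite: KomaTasaki1994, §1] -/
theorem cw1740_false_uniformFloor :
    ¬ (∃ U₀ : ℝ, 0 < U₀ ∧ ∃ c₀ : ℝ, 0 < c₀ ∧ ∀ U ∈ Set.Ioo (0:ℝ) U₀,
        ∃ δ ∈ Set.Icc (3/10 : ℝ) (12/25), ∃ μ : ℝ,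
          Tendsto (fun L : ℕ => ((hubbardTorusWith 2 (L + 1) 1 U μ).groundStateFunctional
            totalNumber).re / ((L + 1 : ℕ) : ℝ) ^ 2) atTop (𝓝 (1 - δ)) ∧
          c₀ ≤ dWaveOrderParameter U μ) := by
  rintro ⟨U₀, hU₀, c₀, hc₀, H⟩
  apply cw1740_false_uniformFloorOn (μ₁ := -(37 : ℝ) / 10) (μ₂ := -(1 : ℝ) / 20)
    (by norm_num) (by norm_num) (by norm_num)
  unfold CwChiralConstructionUniformFloorOn
  refine ⟨min U₀ (1 / 1000), lt_min hU₀ (by norm_num), c₀, hc₀, fun U hU => ?_⟩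
  obtain ⟨δ, hδ, μ, hdens, hfloor⟩ := H U ⟨hU.1, lt_of_lt_of_le hU.2 (min_le_left _ _)⟩
  have hUabs : |U| ≤ 1 / 1000 := by
    rw [abs_of_pos hU.1]; exact (hU.2.le.trans (min_le_right _ _))
  exact ⟨δ, hδ, μ, cwChiralConstruction_densityClause_pins_mu hUabs hδ hdens, hdens, hfloor⟩

/-- **No power-law floor `c·U^p`, `p < 1/2` (verbatim crux).** [cite: KomaTasaki1994, §1] -/
theorem cw1740_false_powerFloor {p : ℝ} (hp : p < 1 / 2) :
    ¬ (∃ U₀ : ℝ, 0 < U₀ ∧ ∃ c : ℝ, 0 < c ∧ ∀ U ∈ Set.Ioo (0:ℝ) U₀,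
        ∃ δ ∈ Set.Icc (3/10 : ℝ) (12/25), ∃ μ : ℝ,
          Tendsto (fun L : ℕ => ((hubbardTorusWith 2 (L + 1) 1 U μ).groundStateFunctional
            totalNumber).re / ((L + 1 : ℕ) : ℝ) ^ 2) atTop (𝓝 (1 - δ)) ∧
          c * U ^ p ≤ dWaveOrderParameter U μ) := by
  rintro ⟨U₀, hU₀, c, hc, H⟩
  apply cw1740_false_powerFloorOn (μ₁ := -(37 : ℝ) / 10) (μ₂ := -(1 : ℝ) / 20)
    (by norm_num) (by norm_num) (by norm_num) hp
  unfold CwChiralConstructionPowerFloorOn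
  refine ⟨min U₀ (1 / 1000), lt_min hU₀ (by norm_num), c, hc, fun U hU => ?_⟩
  obtain ⟨δ, hδ, μ, hdens, hfloor⟩ := H U ⟨hU.1, lt_of_lt_of_le hU.2 (min_le_left _ _)⟩
  have hUabs : |U| ≤ 1 / 1000 := by
    rw [abs_of_pos hU.1]; exact (hU.2.le.trans (min_le_right _ _))
  exact ⟨δ, hδ, μ, cwChiralConstruction_densityClause_pins_mu hUabs hδ hdens, hdens, hfloor⟩

/-- **`0 < U` is load-bearing (verbatim crux).** With `U ∈ [0, U₀)` in place of `U ∈ (0, U₀)` the crux is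
FALSE: at `U = 0` the density clause pins `μ` into `(-4,0)`, where the free gas has order parameter `0`
(`dWaveOrderParameter_free_eq_zero`), while Lean reads the floor `exp(-C/0²)` as `exp 0 = 1`.
[cite: KomaTasaki1994, §1] -/
theorem cw1740_false_withZeroCoupling :
    ¬ (∃ U₀ : ℝ, 0 < U₀ ∧ ∃ C : ℝ, 0 < C ∧ ∀ U ∈ Set.Ico (0:ℝ) U₀,
        ∃ δ ∈ Set.Icc (3/10 : ℝ) (12/25), ∃ μ : ℝ,
          Tendsto (fun L : ℕ => ((hubbardTorusWith 2 (L + 1) 1 U μ).groundStateFunctional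
            totalNumber).re / ((L + 1 : ℕ) : ℝ) ^ 2) atTop (𝓝 (1 - δ)) ∧
          Real.exp (-C / U ^ 2) ≤ dWaveOrderParameter U μ) := by
  rintro ⟨U₀, hU₀, C, _, H⟩
  obtain ⟨δ, hδ, μ, hdens, hfloor⟩ := H 0 ⟨le_rfl, hU₀⟩
  have hμ := cwChiralConstruction_densityClause_pins_mu (U := 0) (by norm_num) hδ hdens
  have h0 := dWaveOrderParameter_free_eq_zero (μ := μ) (by linarith [hμ.1]) (by linarith [hμ.2])
  rw [h0] at hfloor
  have : Real.exp (-C / (0 : ℝ) ^ 2) = 1 := by simp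
  rw [this] at hfloor
  linarith

end Verbatim

/-! ## §H Folklore-level kill test: the second-order Kohn–Luttinger census at `t' = 0` (job j010500)

The crux quantifies `∀ U → 0⁺ ∃ δ ∈ [0.30, 0.48]`, so at the FOLKLORE level it is true iff the B₁g channel is
the leading weak-coupling Cooper instability at SOME density `n = 1 - δ ∈ [0.52, 0.70]` (where another irrep
leads, the B₁g order parameter of the paired ground state is `0` and no floor can hold as `U → 0`). Non-certified
census (script `klcensus/main.py`, job j010500; `ε = -2(cos kx + cos ky)`, Fermi curve with BCS weights
`ds/((2π)²|∇ε|)`, `T`-smoothed static Lindhard `χ₀` on a `512²` grid, kernel `√w χ₀(k+k') √w` — on odd functions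
this IS the triplet vertex `-U²χ₀(k-k')` — full diagonalisation, D₄ classification; most negative eigenvalue per
irrep, `a_χ = -λ_χ`, `T_c ∼ W e^{-1/(a_χ U²)}`):

```
  n    δ     A2g      B1g      B2g      E       leader        (A1g omitted: bare +U not included)
 0.50 0.50  1.8e-4   0.7e-4   4.9e-4   4.7e-4   B2g (d_xy)
 0.55 0.45  1.1e-4   2.1e-4   5.3e-4   5.5e-4   E   (p)
 0.58 0.42  1.2e-4   4.1e-4   5.1e-4   5.2e-4   E   (B2g 2.4 % behind)
 0.60 0.40  1.6e-4   6.8e-4   5.0e-4   4.9e-4   B1g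
 0.64 0.36  1.2e-4  12.9e-4   5.0e-4   4.2e-4   B1g
 0.70 0.30  1.1e-4  23.5e-4   4.3e-4   5.4e-4   B1g (× 4.4 over E)
 0.80 0.20  8.8e-4  48.9e-4   4.4e-4  10.8e-4   B1g
```
Reading: (1) NO folklore kill — B₁g leads on `δ ∈ [0.30, 0.40]`, a third of the window, with the largest margin at
the edge `δ = 0.30`; (2) the first crossing is `B₁g = E` at `n* ≈ 0.59`, `δ* ≈ 0.41`, INSIDE the window with
partner `E`, as the route expects (SimkovicEtAl2016 p. 8); (3) but `B₂g` sits within ~6 % of the bottom at the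
crossing and `E ≈ B₂g` on `n ∈ [0.50, 0.58]`: the kill switch stmt-1741's isolation margin `γ` is tiny and its
certified version needs ~1 % error control of the channel bottoms; (4) `C ≈ 1/a_{B1g} ∼ 4·10²` in this
normalisation: the crux's floor `e^{-C/U²}` is an asymptotic statement with no practical `U₀`.
Cross-check (lite twin j012414): (160,400,0.01) reproduces the table to 3 digits; (240,500,0.005) lowers all `a_χ`
by 2–3 % uniformly with the same leaders (n = 0.55: E; 0.60, 0.64: B1g) — leaders and `n* ∈ (0.55, 0.60)` are
resolution-stable. Caveats: second order only (`O(U³)` terms move boundaries by `O(U)`), `T`-smoothing. -/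

/-! ## §E Why it resists; near-misses and next targets

The ceiling of §C is `O(√U log(1/U))`, the floor asked is `exp(-C/U²)`; everything in between is
exactly the weak-coupling BCS/Kohn–Luttinger regime for which NO rigorous method exists on either
side (WeakCouplingCeiling: convergent fermionic expansions stop at `T ≈ e^{-a/|U|}`, above the KL
scale `e^{-c/U²}`; PerturbativeInvisibilityOfPairing: the order is flat to all orders at `U = 0⁺`).
A refutation of the crux needs `dWaveOrderParameter U μ < exp(-C/U²)` for SOME small `U`, for EVERY
`C`, at EVERY `μ` whose GC density lies in `[0.52, 0.70]` — i.e. a proof that the weakly repulsive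
Hubbard model has no `d_{x²-y²}` order (beyond `exp(-C/U²)` for all `C`, e.g. zero) at any such
filling. KL folklore says the opposite at `n = 0.7` (`δ = 0.3`): B₁g is the leading second-order
instability there in every census (Hlubina 1999; Raghu–Kivelson–Scalapino 2010 Fig. 2; Šimkovic et al.
2016 p. 8), with `λ_{B1g} = a(δ)U² + O(U³)`, `a(0.3) > 0`, so the expected order parameter is
`≍ exp(-1/(a U²))·poly ≥ exp(-C/U²)` for `C > 1/a`. The `∃ δ` quantifier means the route's
crossing-line choice is NOT forced on the prover of THIS item; only if B₁g led NOWHERE in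
`δ ∈ [0.3,0.48]` as `U → 0` would folklore turn against the crux.

Small / finite models are powerless here: every clause is a thermodynamic-limit (`liminf_L`) clause,
and finite tori only enter through bounds uniform in `L` (§C is such a bound).
-/


end Summit.HubbardSuperconductivity.HubbardSuperconductivity.Cruxes.CwChiralConstruction.Disproof

end
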